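import Mathlib.Analysis.Calculus.LocalExtr.Basic
import Mathlib.Analysis.InnerProductSpace.Calculus
import Mathlib.Analysis.SpecialFunctions.Pow.Deriv
import Literature.Analysis.FluidPDE.TorusLpOperatorFactsProofs
import Literature.Analysis.FluidPDE.TransportHolderEstimate
import Literature.Analysis.FunctionSpaces.TorusHolderSobolevEmbedding
import HarnessLib

/-!
# Hölder estimates for smooth solutions of transport–diffusion equations with fractional
# dissipation on the flat torus (De Rosa 2019, §3.1: maximum principle and stability estimates)

L. De Rosa, *Infinitely many Leray–Hopf solutions for the fractional Navier–Stokes equations*,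
Comm. PDE 44 (2019) 335–365 = arXiv:1801.10235, §3.1, proves for the non-local operator
`L u = (v·∇)u + ν(-Δ)^γ u` (`ν > 0`, `0 < γ ≤ 1`) on `𝕋³ × [0,T]`:

* **Thm. 3.1 (maximum principle)**: if `uₜ + Lu ≤ 0` in `𝕋³ × (0,T]` then `max u` is attained at
  `t = 0` ("the proof is standard, since, as for the local case, `(-Δ)^γ u(x₀) ≥ 0` whenever `x₀`
  is a global maximum point of `u`");
* **Prop. 3.2, (3.3)**: a solution of `uₜ + Lu = f`, `u(·,t₀) = u₀`, obeys
  `‖u(t)‖₀ ≤ ‖u₀‖₀ + ∫_{t₀}^t ‖f(s)‖₀ ds`;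
* **Prop. 3.3, (3.6)**: under `(t - t₀)[v]₁ ≤ 1`, `‖u(t)‖_α ≤ e^α (‖u₀‖_α + ∫_{t₀}^t ‖f(τ)‖_α dτ)`,
  `0 ≤ α ≤ 1` (proof: the difference quotient `w = δ_h u/|h|^α` solves a transport–diffusion
  equation in the variables `(x, h)`, "by the maximum principle … and since
  `sup_{h,x} |w| = [u(t)]_α` we get `[u(t)]_α ≤ [u₀]_α + ∫ (α[v]₁[u]_α + [f]_α)`, from which, by
  Gronwall's inequality, (3.6) follows").

These are the fractional twins of the transport estimates (B.1)–(B.2) of Buckmaster–De Lellis–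
Székelyhidi–Vicol (proved in the tree by the method of characteristics,
`Literature/Analysis/FluidPDE/TransportHolderEstimate.lean`), and they are the `§3.1` input of
De Rosa's gluing stage (§5.2, Props. 5.3–5.5; in the tree the named fact `DeRosa.gluingStage`) and
of the local theory of §3.2 (Prop. 3.5). This file **proves** them, for jointly smooth fields on
`[a,b] × T^d` (any finite dimension) with values in `ℝ^d` (the domain of the tree's spectral
fractional Laplacian `Torus.fracLaplacian`), **forward in time** (`t₀ ≤ t`: the dissipation is
irreversible), in exactly the shape of the BDSV file:

* `Torus.inner_fracLaplacian_nonneg_of_forall_le` — **the maximum-point inequality**: if the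
  scalar function `⟨e, u(·)⟩` of a smooth field `u` attains its maximum at `x₀`, then
  `⟨e, (-Δ)^γ u(x₀)⟩ ≥ 0` (`0 < γ < 1`), from the heat-semigroup representation
  `I_γ (-Δ)^γ u(x₀) = ∫₀^∞ s^{-1-γ}(u(x₀) - e^{sΔ}u(x₀)) ds` (`Torus.integral_rpow_smul_sub_heatSmoothing`)
  and `⟨e^{sΔ}u(x₀), e⟩ = ∫ G_s(z)⟨u(x₀ - z), e⟩ dz ≤ ⟨u(x₀), e⟩` (`G_s ≥ 0`, `∫ G_s = 1`);
* `Torus.eSupNorm_fracTransport_le` — **(3.3)**: for a smooth `f` on `[a,b] × T^d` with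
  `∂ₜf + (u·∇)f + ν(-Δ)^γ f = g` pointwise (`ν ≥ 0`, `0 < γ < 1`, `u` and `g` arbitrary) and
  `t₀ ≤ t` in `[a,b]`: `‖f(t)‖_∞ ≤ ‖f(t₀)‖_∞ + (t - t₀) sup_{s ∈ [t₀,t]} ‖g(s)‖_∞`;
* `Torus.eHolderNorm_fracTransport_le` — **(3.6)**, sharp form: if moreover `u` is smooth with
  `‖Du‖ ≤ K` and `0 ≤ α < 1`, then
  `[f(t)]_α ≤ e^{αK(t-t₀)} ([f(t₀)]_α + (t - t₀) sup_{s ∈ [t₀,t]} [g(s)]_α)` (Hölder seminorms of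
  the periodic lifts), and the `C^{0,α}` form `Torus.eContDiffHolderNorm_fracTransport_le`.

## Proof (maximum principle with a barrier; no regularity of `u` is needed for (3.3))

For (3.3) fix `η > 0` and the barrier `B(s) = A + η + (s - t₀)(G + η)` (`‖f(t₀)‖ ≤ A`,
`‖g‖ ≤ G` on `[t₀,t]`). If `⟨f(s,x), e⟩ > B(s)` somewhere (`‖e‖ ≤ 1`), the continuous function
`Θ(s,y,e) = ⟨f(s, proj y), e⟩ - B(s)` has a positive maximum on the compact set
`[t₀,t] × [0,1]^d × B̄(0,1)`, attained at `(s⋆, y⋆, e⋆)` with `s⋆ > t₀` (at `t₀`, `Θ ≤ -η`). There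
`x⋆ = proj y⋆` maximises `⟨f(s⋆,·), e⋆⟩` on `T^d`, so `⟨Df(s⋆,x⋆)w, e⋆⟩ = 0` for all `w` (in
particular the advection term vanishes whatever `u` is) and `⟨(-Δ)^γ f(s⋆)(x⋆), e⋆⟩ ≥ 0`, while
`s ↦ Θ(s, y⋆, e⋆)` is maximal at `s⋆` on `[t₀, s⋆]`, so its one-sided derivative is `≥ 0`:
`⟨∂ₜf(s⋆,x⋆), e⋆⟩ ≥ G + η`. The equation then gives `⟨g(s⋆,x⋆), e⋆⟩ ≥ G + η > G ≥ ⟨g(s⋆,x⋆), e⋆⟩`.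
For (3.6) the same argument is run for
`Θ(s,y,h,e) = e^{-αK(s-t₀)}⟨f(s, proj(y+h)) - f(s, proj y), e⟩ - B̃(s)‖h‖^α`,
`B̃(s) = H₀ + η + (s - t₀)(H₁ + η)`, on `[t₀,t] × [0,1]^d × {ε ≤ ‖h‖ ≤ R} × B̄(0,1)` (small `h` are
harmless because `f` is uniformly Lipschitz in space and `α < 1`; large `h` reduce to the
fundamental domain); at the maximum, translating `y` and `y + h` together kills
`⟨(Df(Q) - Df(P))w, e⟩`, moving the tip `Q = y + h` alone gives
`e^{-αK(s-t₀)}⟨Df(Q)w, e⟩ = B̃ D(‖·‖^α)(h)w`, whence the advection terms contribute at least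
`-αK B̃‖h‖^α` (`‖u(Q) - u(P)‖ ≤ K‖h‖`), which is exactly what the weight `e^{-αK(s-t₀)}` produces
in the time derivative; the dissipation of the increment `f(· + h) - f` is `≥ 0` at its maximum
point by the maximum-point inequality and translation invariance of `(-Δ)^γ`.

## Mathlib / tree search

Tree: `Torus.integral_rpow_smul_sub_heatSmoothing`, `Torus.momentConst_pos`
(`TorusLpOperatorFactsProofs`), `UnboundedOperators.integral_heatKernel_eq_one_holds`,
`heatKernel_pos`, `Torus.eSupNorm_transport_le` / `eHolderNorm_transport_le` (statement shapes,
`TransportHolderEstimate`), `Torus.lipschitzWith_lift_of_norm_fderiv_le`,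
`Torus.mFourierCoeff_comp_add_right` (`TorusHolderSobolevEmbedding`), `IsSmoothSpaceTimeOn.*`
(`TorusSpaceTime`, `TorusCalculusProofs`). Mathlib: `IsCompact.exists_isMaxOn`,
`IsLocalMax.hasFDerivAt_eq_zero`, `IsLocalMaxOn.hasFDerivWithinAt_nonpos`,
`mem_posTangentConeAt_of_segment_subset`, `hasStrictFDerivAt_norm_sq`, `Real.hasDerivAt_rpow_const`.
`lean search 'maximum principle|fracLaplacian.*max|nonlocal.*transport'` in the tree: nothing for
the fractional operator.

## References

* L. De Rosa, Comm. PDE 44 (2019) 335–365 = arXiv:1801.10235, §3.1: Thm. 3.1, Prop. 3.2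
  (3.3)–(3.5), Prop. 3.3 (3.6)–(3.7) and their proofs (pp. 6–7 of the arXiv text). [`Derosa2018`]
* P. Constantin, A. Tarfulea, V. Vicol, *Long time dynamics of forced critical SQG*, CMP 335
  (2015), (4.13) (the equation for the difference quotient, cited in De Rosa's proof of Prop. 3.3).
* T. Buckmaster, C. De Lellis, L. Székelyhidi Jr., V. Vicol, CPAM 72 (2019) = arXiv:1701.08678,
  App. B, Prop. B.1 (B.1)–(B.2) (the Euler twins). [`BuckmasterEtAl2018`]
-/

noncomputable section

open MeasureTheory Set Filter Metric Function UnitAddTorus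
open Literature.Analysis.UnboundedOperators
open scoped NNReal ENNReal ContDiff Topology RealInnerProductSpace

namespace Literature.Analysis.FluidPDE

namespace Torus

open FunctionSpaces FunctionSpaces.Torus

/-! ## The fractional Laplacian: translation invariance, additivity, maximum points -/

section FracLaplacian

variable {d : Type*} [Fintype d] [DecidableEq d]

omit [DecidableEq d] in
/-- **Translation invariance of `(-Δ)^θ`**: `(-Δ)^θ (a(· + h)) = ((-Δ)^θ a)(· + h)` (the Fourier
coefficients of the translate are `e_k(h) â(k)`, and `e_k(x) e_k(h) = e_k(x + h)`; termwise in the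
defining series, no convergence needed). [folklore] -/
theorem fracLaplacian_comp_add_right (θ : ℝ) (a : UnitAddTorus d → EuclideanSpace ℝ d)
    (h : UnitAddTorus d) :
    fracLaplacian θ (fun x => a (x + h)) = fun x => fracLaplacian θ a (x + h) := by
  funext x
  rw [fracLaplacian_def, fracLaplacian_def]
  congr 1
  refine tsum_congr fun k => ?_
  have hc : mFourierCoeff (EuclideanSpace.complexify ∘ fun y => a (y + h)) k =
      mFourier k h • mFourierCoeff (EuclideanSpace.complexify ∘ a) k :=
    mFourierCoeff_comp_add_right (EuclideanSpace.complexify ∘ a) h k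
  rw [hc, smul_smul, mFourier_apply_add, mul_comm]

/-- **Additivity of `(-Δ)^θ` on smooth fields** (`θ ≥ 0`): `(-Δ)^θ (a - b) = (-Δ)^θ a - (-Δ)^θ b`
(the defining series converge absolutely for smooth fields). [folklore] -/
theorem fracLaplacian_sub {θ : ℝ} (hθ : 0 ≤ θ) {a b : UnitAddTorus d → EuclideanSpace ℝ d}
    (ha : IsSmooth a) (hb : IsSmooth b) :
    fracLaplacian θ (fun x => a x - b x) = fun x => fracLaplacian θ a x - fracLaplacian θ b x := by
  funext x
  have hab : IsSmooth (fun y => a y - b y) := ha.sub hb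
  have h1 := hasSum_fracLaplacian hθ ha x
  have h2 := hasSum_fracLaplacian hθ hb x
  have h3 := hasSum_fracLaplacian hθ hab x
  refine h3.unique ?_
  have hcoef : ∀ k, mFourierCoeff (EuclideanSpace.complexify ∘ fun y => a y - b y) k =
      mFourierCoeff (EuclideanSpace.complexify ∘ a) k - mFourierCoeff (EuclideanSpace.complexify ∘ b) k := by
    intro k
    have hfun : (EuclideanSpace.complexify ∘ fun y => a y - b y) =
        (EuclideanSpace.complexify ∘ a) - (EuclideanSpace.complexify ∘ b) := by
      funext y
      simp [map_sub]
    rw [hfun, mFourierCoeff_sub (integrable_complexify_comp ha.integrable)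
      (integrable_complexify_comp hb.integrable)]
  have hfun : (fun k : d → ℤ => EuclideanSpace.realPart (fracSymbol θ k •
      (mFourier k x • mFourierCoeff (EuclideanSpace.complexify ∘ fun y => a y - b y) k))) =
      fun k => EuclideanSpace.realPart (fracSymbol θ k •
        (mFourier k x • mFourierCoeff (EuclideanSpace.complexify ∘ a) k)) -
        EuclideanSpace.realPart (fracSymbol θ k •
        (mFourier k x • mFourierCoeff (EuclideanSpace.complexify ∘ b) k)) := by
    funext k
    rw [hcoef, smul_sub, smul_sub, map_sub]
  rw [hfun]
  exact h1.sub h2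

omit [DecidableEq d] in
/-- The heat smoothing of a continuous field is a convergent integral: `z ↦ G_s(z) u(x - proj z)`
is integrable on `ℝ^d` for `s > 0`. [folklore] -/
theorem integrable_heatKernel_smul_comp {u : UnitAddTorus d → EuclideanSpace ℝ d} (hu : Continuous u)
    {s : ℝ} (hs : 0 < s) (x : UnitAddTorus d) :
    Integrable (fun z : EuclideanSpace ℝ d => heatKernel s z • u (x - proj z)) := by
  obtain ⟨C, hC⟩ := (isCompact_univ.image hu).isBounded.exists_norm_le
  have hC' : ∀ y, ‖u y‖ ≤ C := fun y => hC _ (mem_image_of_mem u (mem_univ y))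
  have hmeas : AEStronglyMeasurable (fun z : EuclideanSpace ℝ d => u (x - proj z)) volume :=
    (hu.comp (continuous_const.sub continuous_proj)).aestronglyMeasurable
  exact Integrable.smul_of_top_left (integrable_heatKernel_holds hs)
    (memLp_top_of_bound hmeas C (Eventually.of_forall fun z => hC' _))

omit [DecidableEq d] in
/-- **Heat smoothing does not increase maxima** (positivity and unit mass of the Gauss kernel):
if `⟨u(·), e⟩ ≤ ⟨u(x₀), e⟩` everywhere then `⟨e^{sΔ}u(x), e⟩ ≤ ⟨u(x₀), e⟩` for every `x` and
`s > 0`. [folklore] -/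
theorem inner_heatSmoothing_le {u : UnitAddTorus d → EuclideanSpace ℝ d} (hu : Continuous u)
    {e : EuclideanSpace ℝ d} {x₀ : UnitAddTorus d} (hmax : ∀ x, ⟪e, u x⟫ ≤ ⟪e, u x₀⟫)
    {s : ℝ} (hs : 0 < s) (x : UnitAddTorus d) :
    ⟪e, ∫ z : EuclideanSpace ℝ d, heatKernel s z • u (x - proj z)⟫ ≤ ⟪e, u x₀⟫ := by
  have hint := integrable_heatKernel_smul_comp hu hs x
  rw [← integral_inner hint e]
  have h1 : ∀ z : EuclideanSpace ℝ d, ⟪e, heatKernel s z • u (x - proj z)⟫ ≤ heatKernel s z * ⟪e, u x₀⟫ := by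
    intro z
    rw [real_inner_smul_right]
    exact mul_le_mul_of_nonneg_left (hmax _) (heatKernel_pos hs z).le
  have h2 : Integrable fun z : EuclideanSpace ℝ d => heatKernel s z * ⟪e, u x₀⟫ :=
    (integrable_heatKernel_holds hs).mul_const _
  calc ∫ z : EuclideanSpace ℝ d, ⟪e, heatKernel s z • u (x - proj z)⟫
      ≤ ∫ z : EuclideanSpace ℝ d, heatKernel s z * ⟪e, u x₀⟫ :=
        integral_mono (hint.const_inner e) h2 h1
    _ = ⟪e, u x₀⟫ := by
        rw [integral_mul_const, integral_heatKernel_eq_one_holds hs, one_mul]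

/-- **The maximum-point inequality for the fractional Laplacian** (De Rosa 2019, §3.1: "we have
that `(-Δ)^γ u(x₀) ≥ 0` whenever `x₀` is a global maximum point of `u`", here for the scalar
function `⟨u(·), e⟩` of a smooth field `u : T^d → ℝ^d` and `0 < γ < 1`): if
`⟨u(x), e⟩ ≤ ⟨u(x₀), e⟩` for all `x`, then `0 ≤ ⟨(-Δ)^γ u(x₀), e⟩`. Proof: by the heat-semigroup
representation `I_γ (-Δ)^γ u(x₀) = ∫₀^∞ s^{-1-γ}(u(x₀) - e^{sΔ}u(x₀)) ds` with `I_γ > 0`, and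
`⟨e^{sΔ}u(x₀), e⟩ ≤ ⟨u(x₀), e⟩`. [cite: Derosa2018, §3.1 Thm. 3.1 (proof)] -/
theorem inner_fracLaplacian_nonneg_of_forall_le {γ : ℝ} (hγ0 : 0 < γ) (hγ1 : γ < 1)
    {u : UnitAddTorus d → EuclideanSpace ℝ d} (hu : IsSmooth u) {e : EuclideanSpace ℝ d}
    {x₀ : UnitAddTorus d} (hmax : ∀ x, ⟪e, u x⟫ ≤ ⟪e, u x₀⟫) :
    0 ≤ ⟪e, fracLaplacian γ u x₀⟫ := by
  obtain ⟨hint, heq⟩ := integral_rpow_smul_sub_heatSmoothing hγ0 hγ1 hu x₀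
  have hI0 : 0 < ∫ t in Ioi (0 : ℝ), t ^ (-1 - γ) * (1 - Real.exp (-t)) := momentConst_pos hγ0 hγ1
  set I : ℝ := ∫ t in Ioi (0 : ℝ), t ^ (-1 - γ) * (1 - Real.exp (-t)) with hI
  set F : ℝ → EuclideanSpace ℝ d := fun s => s ^ (-1 - γ) •
    (u x₀ - ∫ z : EuclideanSpace ℝ d, heatKernel s z • u (x₀ - proj z)) with hF
  -- the inner product of the representation with `e`
  have h1 : ⟪e, ∫ s in Ioi 0, F s⟫ = I * ⟪e, fracLaplacian γ u x₀⟫ := by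
    rw [heq, real_inner_smul_right]
  have h2 : ⟪e, ∫ s in Ioi 0, F s⟫ = ∫ s in Ioi 0, ⟪e, F s⟫ := (integral_inner hint e).symm
  have h3 : 0 ≤ ∫ s in Ioi 0, ⟪e, F s⟫ := by
    refine setIntegral_nonneg measurableSet_Ioi fun s hs => ?_
    rw [hF]
    dsimp only
    rw [real_inner_smul_right, inner_sub_right]
    refine mul_nonneg (Real.rpow_nonneg (le_of_lt hs) _) ?_
    rw [sub_nonneg]
    exact inner_heatSmoothing_le hu.continuous hmax hs x₀
  rw [← h2, h1] at h3
  exact nonneg_of_mul_nonneg_right h3 hI0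

end FracLaplacian

/-! ## First-order conditions at maximum points -/

section Extremum

variable {d : Type*} [Fintype d]

/-- At a maximum point `x₀` of the scalar function `⟨e, φ(·)⟩` of a `C¹` field on the torus, the
derivative of `φ` is orthogonal to `e`: `⟨e, Dφ(x₀)w⟩ = 0` for all `w` (Fermat; the periodic lift of
`⟨e, φ⟩` has a local maximum at any lift of `x₀`). [folklore] -/
theorem inner_fderiv_eq_zero_of_forall_le {φ : UnitAddTorus d → EuclideanSpace ℝ d}
    (hφ : IsContDiff 1 φ) {e : EuclideanSpace ℝ d} {x₀ : UnitAddTorus d}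
    (hmax : ∀ x, ⟪e, φ x⟫ ≤ ⟪e, φ x₀⟫) (w : EuclideanSpace ℝ d) :
    ⟪e, Torus.fderiv φ x₀ w⟫ = 0 := by
  obtain ⟨y₀, rfl⟩ := proj_surjective x₀
  set ψ : EuclideanSpace ℝ d → ℝ := fun y => ⟪e, lift φ y⟫ with hψ
  have hlift : HasFDerivAt (lift φ) (_root_.fderiv ℝ (lift φ) y₀) y₀ :=
    ((hφ.differentiable one_ne_zero) y₀).hasFDerivAt
  have hψd : HasFDerivAt ψ ((innerSL ℝ e).comp (_root_.fderiv ℝ (lift φ) y₀)) y₀ :=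
    (innerSL ℝ e).hasFDerivAt.comp y₀ hlift
  have hloc : IsLocalMax ψ y₀ := Filter.Eventually.of_forall fun y => hmax (proj y)
  have h0 := hloc.hasFDerivAt_eq_zero hψd
  have h1 := DFunLike.congr_fun h0 w
  rw [fderiv_lift] at h1
  simpa using h1

/-- One-sided Fermat: if `ψ ≤ ψ(s⋆)` on `[t₀, s⋆]` with `t₀ < s⋆` and `ψ` has derivative `ψ'` at
`s⋆` within a set containing `[t₀, s⋆]`, then `0 ≤ ψ'`. [folklore] -/
theorem deriv_nonneg_of_isMaxOn_Icc {ψ : ℝ → ℝ} {ψ' t₀ sStar : ℝ} {S : Set ℝ} (hlt : t₀ < sStar)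
    (hS : Icc t₀ sStar ⊆ S) (hd : HasDerivWithinAt ψ ψ' S sStar)
    (hmax : ∀ s ∈ Icc t₀ sStar, ψ s ≤ ψ sStar) : 0 ≤ ψ' := by
  have hd' : HasFDerivWithinAt ψ (ContinuousLinearMap.smulRight (1 : ℝ →L[ℝ] ℝ) ψ') (Icc t₀ sStar) sStar :=
    (hd.mono hS).hasFDerivWithinAt
  have hmax' : IsMaxOn ψ (Icc t₀ sStar) sStar := isMaxOn_iff.2 hmax
  have hloc : IsLocalMaxOn ψ (Icc t₀ sStar) sStar := hmax'.localize
  have hseg : segment ℝ sStar (sStar + (t₀ - sStar)) ⊆ Icc t₀ sStar := by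
    rw [add_sub_cancel, segment_symm, segment_eq_Icc hlt.le]
  have hy : t₀ - sStar ∈ posTangentConeAt (Icc t₀ sStar) sStar :=
    mem_posTangentConeAt_of_segment_subset hseg
  have h := hloc.hasFDerivWithinAt_nonpos hd' hy
  simp only [ContinuousLinearMap.smulRight_apply, smul_eq_mul] at h
  have h' : (t₀ - sStar) * ψ' ≤ 0 := by simpa using h
  nlinarith

end Extremum

/-! ## (3.3): the `L^∞` estimate by the maximum principle -/

section SupNorm

variable {d : Type*} [Fintype d] [DecidableEq d]

variable {a b : ℝ} {u : ℝ → UnitAddTorus d → EuclideanSpace ℝ d}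
  {f g : ℝ → UnitAddTorus d → EuclideanSpace ℝ d} {ν γ : ℝ}

/-- **Maximum principle with a linear barrier** (the core of De Rosa's Thm. 3.1 / Prop. 3.2):
for a smooth `f` on `[a,b] × T^d` with `∂ₜf + (u·∇)f + ν(-Δ)^γ f = g` (`ν ≥ 0`, `0 < γ < 1`),
`t₀ ≤ t` in `[a,b]`, `‖f(t₀)‖ ≤ A`, `‖g‖ ≤ G` on `[t₀,t] × T^d`, and every `η > 0`:
`⟨e, f(s,x)⟩ ≤ A + η + (s - t₀)(G + η)` for all `s ∈ [t₀,t]`, `x`, `‖e‖ ≤ 1`.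
[cite: Derosa2018, §3.1 Thm. 3.1, Prop. 3.2 (3.3)] -/
theorem inner_le_barrier_of_fracTransport (hf : IsSmoothSpaceTimeOn (Icc a b) f)
    (hν : 0 ≤ ν) (hγ0 : 0 < γ) (hγ1 : γ < 1)
    (heq : ∀ s ∈ Icc a b, ∀ x, timeDerivWithin (Icc a b) f s x + convect (u s) (f s) x +
      ν • fracLaplacian γ (f s) x = g s x)
    {t₀ t : ℝ} (ht₀ : t₀ ∈ Icc a b) (ht : t ∈ Icc a b) {A G : ℝ}
    (hA : ∀ x, ‖f t₀ x‖ ≤ A) (hG : ∀ s ∈ Icc t₀ t, ∀ x, ‖g s x‖ ≤ G) {η : ℝ} (hη : 0 < η)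
    {s : ℝ} (hs : s ∈ Icc t₀ t) (x : UnitAddTorus d) {e : EuclideanSpace ℝ d} (he : ‖e‖ ≤ 1) :
    ⟪e, f s x⟫ ≤ A + η + (s - t₀) * (G + η) := by
  classical
  -- the barrier and the defect function on the compact parameter set
  set B : ℝ → ℝ := fun σ => A + η + (σ - t₀) * (G + η) with hB
  by_contra hcon
  push Not at hcon
  have hsub : Icc t₀ t ⊆ Icc a b := Icc_subset_Icc ht₀.1 ht.2
  have hA0 : 0 ≤ A := (norm_nonneg _).trans (hA x)
  have hG0 : 0 ≤ G := (norm_nonneg _).trans (hG s hs x)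
  set cube : Set (EuclideanSpace ℝ d) :=
    (WithLp.toLp 2) '' (Set.pi univ fun _ : d => Icc (0 : ℝ) 1) with hcube
  set K : Set (ℝ × EuclideanSpace ℝ d × EuclideanSpace ℝ d) :=
    Icc t₀ t ×ˢ (cube ×ˢ closedBall (0 : EuclideanSpace ℝ d) 1) with hK
  have hKc : IsCompact K :=
    isCompact_Icc.prod (isCompact_toLp_image_pi_Icc.prod (isCompact_closedBall _ _))
  set Θ : ℝ × EuclideanSpace ℝ d × EuclideanSpace ℝ d → ℝ :=
    fun p => ⟪p.2.2, f p.1 (proj p.2.1)⟫ - B p.1 with hΘ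
  have hmemK : ∀ {σ : ℝ} (_ : σ ∈ Icc t₀ t) (z : UnitAddTorus d) {e' : EuclideanSpace ℝ d}
      (_ : ‖e'‖ ≤ 1), ((σ, repr z, e') : ℝ × EuclideanSpace ℝ d × EuclideanSpace ℝ d) ∈ K := by
    intro σ hσ z e' he'
    refine mk_mem_prod hσ (mk_mem_prod (repr_mem_toLp_image_pi_Icc z) ?_)
    rwa [mem_closedBall, dist_zero_right]
  have hΘc : ContinuousOn Θ K := by
    have h1 : ContinuousOn (fun p : ℝ × EuclideanSpace ℝ d × EuclideanSpace ℝ d => f p.1 (proj p.2.1)) K := by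
      have hc := hf.continuousOn_stLift
      have h2 : Continuous fun p : ℝ × EuclideanSpace ℝ d × EuclideanSpace ℝ d =>
          ((p.1, p.2.1) : ℝ × EuclideanSpace ℝ d) := by fun_prop
      refine hc.comp h2.continuousOn fun p hp => ?_
      exact mk_mem_prod (hsub (mem_prod.1 hp).1) (mem_univ _)
    have h2 : ContinuousOn (fun p : ℝ × EuclideanSpace ℝ d × EuclideanSpace ℝ d => p.2.2) K :=
      (continuous_snd.comp continuous_snd).continuousOn
    have h3 : ContinuousOn (fun p : ℝ × EuclideanSpace ℝ d × EuclideanSpace ℝ d => B p.1) K := by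
      refine Continuous.continuousOn ?_
      simp only [hB]
      fun_prop
    exact (h2.inner h1).sub h3
  have hKne : K.Nonempty := ⟨_, hmemK hs x he⟩
  obtain ⟨p, hpK, hpmax⟩ := hKc.exists_isMaxOn hKne hΘc
  -- name the maximiser
  set sS : ℝ := p.1 with hsS
  set yS : EuclideanSpace ℝ d := p.2.1 with hyS
  set eS : EuclideanSpace ℝ d := p.2.2 with heS
  set xS : UnitAddTorus d := proj yS with hxS
  have hp_eq : p = (sS, yS, eS) := by simp [hsS, hyS, heS]
  have hsS_mem : sS ∈ Icc t₀ t := by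
    have := (mem_prod.1 hpK).1; simpa [hsS] using this
  have heS_le : ‖eS‖ ≤ 1 := by
    have h := (mem_prod.1 (mem_prod.1 hpK).2).2
    rwa [mem_closedBall, dist_zero_right] at h
  have hsSab : sS ∈ Icc a b := hsub hsS_mem
  have hΘp : Θ p = ⟪eS, f sS xS⟫ - B sS := by rw [hp_eq]
  -- the value at the maximiser is positive
  have hval : ∀ {σ : ℝ} (_ : σ ∈ Icc t₀ t) (z : UnitAddTorus d) {e' : EuclideanSpace ℝ d}
      (_ : ‖e'‖ ≤ 1), ⟪e', f σ z⟫ - B σ ≤ ⟪eS, f sS xS⟫ - B sS := by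
    intro σ hσ z e' he'
    have h := hpmax (hmemK hσ z he')
    rw [hΘp] at h
    simpa [hΘ, proj_repr] using h
  have hpos : 0 < ⟪eS, f sS xS⟫ - B sS := lt_of_lt_of_le (sub_pos.2 hcon) (hval hs x he)
  -- (i) the maximiser is not at the initial time
  have hlt : t₀ < sS := by
    rcases eq_or_lt_of_le hsS_mem.1 with h | h
    · exfalso
      have h1 : ⟪eS, f t₀ xS⟫ ≤ A :=
        calc ⟪eS, f t₀ xS⟫ ≤ ‖eS‖ * ‖f t₀ xS‖ := real_inner_le_norm _ _
          _ ≤ 1 * A := mul_le_mul heS_le (hA _) (norm_nonneg _) zero_le_one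
          _ = A := one_mul A
      have h2 : B t₀ = A + η := by simp [hB]
      rw [← h] at hpos
      rw [h2] at hpos
      linarith
    · exact h
  -- (ii) spatial maximality at time `sS`
  have hxmax : ∀ z, ⟪eS, f sS z⟫ ≤ ⟪eS, f sS xS⟫ := fun z => by
    have h := hval hsS_mem z heS_le
    linarith
  have hfS : IsSmooth (f sS) := hf.isSmooth_slice hsSab
  have hD : ⟪eS, convect (u sS) (f sS) xS⟫ = 0 :=
    inner_fderiv_eq_zero_of_forall_le (hfS.isContDiff (by simp)) hxmax _
  have hL : 0 ≤ ⟪eS, fracLaplacian γ (f sS) xS⟫ :=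
    inner_fracLaplacian_nonneg_of_forall_le hγ0 hγ1 hfS hxmax
  -- (iii) temporal maximality on `[t₀, sS]`
  set ψ : ℝ → ℝ := fun σ => ⟪eS, f σ xS⟫ - B σ with hψ
  have hψd : HasDerivWithinAt ψ (⟪eS, timeDerivWithin (Icc a b) f sS xS⟫ - (G + η)) (Icc a b) sS := by
    have h1 := hf.hasDerivWithinAt_slice hsSab xS
    have h3 : HasDerivWithinAt (fun σ => ⟪eS, f σ xS⟫) (⟪eS, timeDerivWithin (Icc a b) f sS xS⟫)
        (Icc a b) sS := by
      have h := ((innerSL ℝ eS).hasFDerivAt).comp_hasDerivWithinAt sS h1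
      simpa [Function.comp_def] using h
    have hB' : HasDerivWithinAt B (G + η) (Icc a b) sS := by
      have h4 : HasDerivAt (fun σ : ℝ => A + η + (σ - t₀) * (G + η)) (G + η) sS := by
        have h5 := ((hasDerivAt_id sS).sub_const t₀).mul_const (G + η)
        simpa using h5.const_add (A + η)
      exact h4.hasDerivWithinAt
    exact h3.sub hB'
  have hψmax : ∀ σ ∈ Icc t₀ sS, ψ σ ≤ ψ sS := by
    intro σ hσ
    have hσt : σ ∈ Icc t₀ t := ⟨hσ.1, hσ.2.trans hsS_mem.2⟩
    have h := hval hσt xS heS_le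
    have hre : f σ (proj (repr xS)) = f σ xS := by rw [proj_repr]
    simpa [hψ] using h
  have htime : 0 ≤ ⟪eS, timeDerivWithin (Icc a b) f sS xS⟫ - (G + η) :=
    deriv_nonneg_of_isMaxOn_Icc hlt (Icc_subset_Icc ht₀.1 hsSab.2) hψd hψmax
  -- (iv) the equation at the maximiser
  have heqS := congrArg (fun v => ⟪eS, v⟫) (heq sS hsSab xS)
  simp only [inner_add_right, real_inner_smul_right] at heqS
  have hg : ⟪eS, g sS xS⟫ ≤ G :=
    calc ⟪eS, g sS xS⟫ ≤ ‖eS‖ * ‖g sS xS‖ := real_inner_le_norm _ _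
      _ ≤ 1 * G := mul_le_mul heS_le (hG sS hsS_mem xS) (norm_nonneg _) zero_le_one
      _ = G := one_mul G
  have hνL : 0 ≤ ν * ⟪eS, fracLaplacian γ (f sS) xS⟫ := mul_nonneg hν hL
  linarith

/-- **`L^∞` estimate for transport–diffusion with fractional dissipation** (De Rosa 2019,
Prop. 3.2 (3.3), pointwise real form): for a smooth `f` on `[a,b] × T^d` with
`∂ₜf + (u·∇)f + ν(-Δ)^γ f = g` (`ν ≥ 0`, `0 < γ < 1`; no assumption on `u`), `t₀ ≤ t` in `[a,b]`,
`‖f(t₀)‖ ≤ A` and `‖g‖ ≤ G` on `[t₀,t] × T^d`: `‖f(t,x)‖ ≤ A + (t - t₀) G`.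
[cite: Derosa2018, §3.1 Prop. 3.2 (3.3)] -/
theorem norm_fracTransport_le (hf : IsSmoothSpaceTimeOn (Icc a b) f)
    (hν : 0 ≤ ν) (hγ0 : 0 < γ) (hγ1 : γ < 1)
    (heq : ∀ s ∈ Icc a b, ∀ x, timeDerivWithin (Icc a b) f s x + convect (u s) (f s) x +
      ν • fracLaplacian γ (f s) x = g s x)
    {t₀ t : ℝ} (ht₀ : t₀ ∈ Icc a b) (ht : t ∈ Icc a b) (ht₀t : t₀ ≤ t) {A G : ℝ}
    (hA : ∀ x, ‖f t₀ x‖ ≤ A) (hG : ∀ s ∈ Icc t₀ t, ∀ x, ‖g s x‖ ≤ G) (x : UnitAddTorus d) :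
    ‖f t x‖ ≤ A + (t - t₀) * G := by
  have htt : t ∈ Icc t₀ t := ⟨ht₀t, le_rfl⟩
  have hA0 : 0 ≤ A := (norm_nonneg _).trans (hA x)
  have hG0 : 0 ≤ G := (norm_nonneg _).trans (hG t htt x)
  have hT0 : 0 ≤ t - t₀ := sub_nonneg.2 ht₀t
  -- the estimate for every `η > 0`
  have key : ∀ η : ℝ, 0 < η → ‖f t x‖ ≤ A + η + (t - t₀) * (G + η) := by
    intro η hη
    by_cases h0 : f t x = 0
    · rw [h0, norm_zero]; positivity
    · set e : EuclideanSpace ℝ d := ‖f t x‖⁻¹ • f t x with he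
      have hn : 0 < ‖f t x‖ := norm_pos_iff.2 h0
      have he1 : ‖e‖ ≤ 1 := by
        rw [he, norm_smul, norm_inv, norm_norm, inv_mul_cancel₀ hn.ne']
      have hinner : ⟪e, f t x⟫ = ‖f t x‖ := by
        rw [he, real_inner_smul_left, real_inner_self_eq_norm_sq, pow_two, ← mul_assoc,
          inv_mul_cancel₀ hn.ne', one_mul]
      rw [← hinner]
      exact inner_le_barrier_of_fracTransport hf hν hγ0 hγ1 heq ht₀ ht hA hG hη htt x he1
  refine le_of_forall_pos_le_add fun ε hε => ?_
  have h1 : 0 < 1 + (t - t₀) := by linarith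
  have h := key (ε / (1 + (t - t₀))) (div_pos hε h1)
  have h2 : A + ε / (1 + (t - t₀)) + (t - t₀) * (G + ε / (1 + (t - t₀))) = A + (t - t₀) * G + ε := by
    field_simp
    ring
  linarith

/-- **`L^∞` transport–diffusion estimate** (De Rosa 2019, Prop. 3.2 (3.3); the fractional twin of
BDSV (B.1), `Torus.eSupNorm_transport_le`): for a smooth solution of
`∂ₜf + (u·∇)f + ν(-Δ)^γ f = g` on `[a,b] × T^d` (`ν ≥ 0`, `0 < γ < 1`, `u` arbitrary) and
`t₀ ≤ t` in `[a,b]`, `‖f(t)‖_∞ ≤ ‖f(t₀)‖_∞ + (t - t₀) sup_{s ∈ [t₀,t]} ‖g(s)‖_∞`.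
[cite: Derosa2018, §3.1 Prop. 3.2 (3.3)] -/
theorem eSupNorm_fracTransport_le (hf : IsSmoothSpaceTimeOn (Icc a b) f)
    (hν : 0 ≤ ν) (hγ0 : 0 < γ) (hγ1 : γ < 1)
    (heq : ∀ s ∈ Icc a b, ∀ x, timeDerivWithin (Icc a b) f s x + convect (u s) (f s) x +
      ν • fracLaplacian γ (f s) x = g s x)
    {t₀ t : ℝ} (ht₀ : t₀ ∈ Icc a b) (ht : t ∈ Icc a b) (ht₀t : t₀ ≤ t) :
    eSupNorm (f t) ≤ eSupNorm (f t₀) + ENNReal.ofReal (t - t₀) * ⨆ s ∈ Icc t₀ t, eSupNorm (g s) := by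
  set Sf := eSupNorm (f t₀) with hSf
  set Sg := ⨆ s ∈ Icc t₀ t, eSupNorm (g s) with hSg
  by_cases hfT : Sf = ⊤
  · rw [hfT, top_add]; exact le_top
  rcases eq_or_lt_of_le ht₀t with rfl | htt
  · simp [hSf]
  by_cases hgT : Sg = ⊤
  · have hpos : ENNReal.ofReal (t - t₀) ≠ 0 := by
      rw [Ne, ENNReal.ofReal_eq_zero, not_le, sub_pos]
      exact htt
    rw [hgT, ENNReal.mul_top hpos, add_top]; exact le_top
  -- real bounds
  have hSf' : ∀ x, ‖f t₀ x‖ ≤ Sf.toReal := fun x => by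
    rw [← ENNReal.ofReal_le_iff_le_toReal hfT, ofReal_norm]
    exact enorm_le_eSupNorm _ x
  have hSg' : ∀ s ∈ Icc t₀ t, ∀ x, ‖g s x‖ ≤ Sg.toReal := fun s hs x => by
    rw [← ENNReal.ofReal_le_iff_le_toReal hgT, ofReal_norm]
    exact (enorm_le_eSupNorm _ x).trans (le_iSup₂ (f := fun s _ => eSupNorm (g s)) s hs)
  refine iSup_le fun x => ?_
  have h2 := norm_fracTransport_le hf hν hγ0 hγ1 heq ht₀ ht ht₀t hSf' hSg' x
  calc ‖f t x‖ₑ = ENNReal.ofReal ‖f t x‖ := (ofReal_norm _).symm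
    _ ≤ ENNReal.ofReal (Sf.toReal + (t - t₀) * Sg.toReal) := ENNReal.ofReal_le_ofReal h2
    _ = Sf + ENNReal.ofReal (t - t₀) * Sg := by
        rw [ENNReal.ofReal_add ENNReal.toReal_nonneg (by nlinarith [ENNReal.toReal_nonneg (a := Sg)]),
          ENNReal.ofReal_mul (sub_nonneg.2 ht₀t), ENNReal.ofReal_toReal hfT, ENNReal.ofReal_toReal hgT]

end SupNorm

/-! ## Tools for the Hölder estimate -/

section HolderTools

variable {d : Type*} [Fintype d]

/-- **Uniform spatial Lipschitz bound** for a jointly smooth field on `[a,b] × T^d` (`a < b`):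
the periodic lifts of the slices are `L`-Lipschitz with one constant `L` (the partial
derivatives are jointly smooth, hence bounded on the compact slab). [folklore] -/
theorem exists_lipschitz_slice {a b : ℝ} (hab : a < b)
    {f : ℝ → UnitAddTorus d → EuclideanSpace ℝ d} (hf : IsSmoothSpaceTimeOn (Icc a b) f) :
    ∃ L : ℝ, 0 ≤ L ∧ ∀ s ∈ Icc a b, ∀ z₁ z₂ : EuclideanSpace ℝ d,
      ‖f s (proj z₁) - f s (proj z₂)‖ ≤ L * ‖z₁ - z₂‖ := by
  classical
  have hD : ∀ k, IsSmoothSpaceTimeOn (Icc a b) (fun t => partialDeriv k (f t)) := fun k =>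
    hf.partialDeriv (uniqueDiffOn_Icc hab) k
  choose M hM using fun k => (hD k).exists_norm_le_of_isCompact isCompact_Icc subset_rfl
  have ha : a ∈ Icc a b := left_mem_Icc.2 hab.le
  have hM0 : ∀ k, 0 ≤ M k := fun k => (norm_nonneg _).trans (hM k a ha 0)
  have hsum0 : 0 ≤ ∑ k, M k := Finset.sum_nonneg fun k _ => hM0 k
  refine ⟨∑ k, M k, hsum0, fun s hs z₁ z₂ => ?_⟩
  have hfs : IsContDiff 1 (f s) := (hf.isSmooth_slice hs).isContDiff (by simp)
  have hbound : ∀ x, ‖Torus.fderiv (f s) x‖ ≤ ∑ k, M k := by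
    intro x
    refine ContinuousLinearMap.opNorm_le_bound _ hsum0 fun w => ?_
    rw [fderiv_apply_eq_sum_partialDeriv hfs, Finset.sum_mul]
    refine (norm_sum_le _ _).trans (Finset.sum_le_sum fun k _ => ?_)
    rw [norm_smul, mul_comm]
    exact mul_le_mul (hM k s hs x) (PiLp.norm_apply_le w k) (norm_nonneg _) (hM0 k)
  have hLip := lipschitzWith_lift_of_norm_fderiv_le hfs (K := ⟨∑ k, M k, hsum0⟩) hbound
  exact hLip.norm_sub_le z₁ z₂

/-- Every vector of `ℝ^d` is congruent modulo `ℤ^d` to one in a fixed ball, of norm not larger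
than its own: given `‖repr z‖ ≤ R₀` for all `z`, for every `h` there is `h'` with `proj h' = proj h`,
`‖h'‖ ≤ R₀` and `‖h'‖ ≤ ‖h‖`. [folklore] -/
theorem exists_short_representative {R₀ : ℝ} (hR₀ : ∀ z : UnitAddTorus d, ‖repr z‖ ≤ R₀)
    (h : EuclideanSpace ℝ d) :
    ∃ h' : EuclideanSpace ℝ d, proj h' = proj h ∧ ‖h'‖ ≤ R₀ ∧ ‖h'‖ ≤ ‖h‖ := by
  by_cases hh : ‖h‖ ≤ R₀
  · exact ⟨h, rfl, hh, le_rfl⟩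
  · refine ⟨repr (proj h), proj_repr _, hR₀ _, ?_⟩
    exact (hR₀ _).trans (le_of_lt (not_le.1 hh))

/-- A bound for the canonical representatives: `‖repr z‖ ≤ R₀` for all `z ∈ T^d`, for some `R₀`
(the image of the unit cube is compact). [folklore] -/
theorem exists_norm_repr_le (d : Type*) [Fintype d] :
    ∃ R₀ : ℝ, 0 < R₀ ∧ ∀ z : UnitAddTorus d, ‖repr z‖ ≤ R₀ := by
  obtain ⟨R, hR⟩ := (isCompact_toLp_image_pi_Icc (d := d)).isBounded.subset_closedBall 0
  refine ⟨max R 1, lt_max_of_lt_right one_pos, fun z => ?_⟩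
  have h := hR (repr_mem_toLp_image_pi_Icc z)
  rw [mem_closedBall, dist_zero_right] at h
  exact h.trans (le_max_left _ _)

/-- **The derivative of `h ↦ ‖h‖^α` away from the origin** (real inner product space, `α ≥ 0`):
at `h₀ ≠ 0` it is a continuous linear form `N'` with `|N' w| ≤ α ‖h₀‖^{α-1} ‖w‖`
(`N' w = α‖h₀‖^{α-2}⟨h₀, w⟩`, chain rule through `‖h‖^α = (‖h‖²)^{α/2}`). [folklore] -/
theorem exists_hasFDerivAt_norm_rpow {E : Type*} [NormedAddCommGroup E] [InnerProductSpace ℝ E]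
    {α : ℝ} (hα : 0 ≤ α) {h₀ : E} (hh₀ : h₀ ≠ 0) :
    ∃ N' : E →L[ℝ] ℝ, HasFDerivAt (fun h : E => ‖h‖ ^ α) N' h₀ ∧
      ∀ w, |N' w| ≤ α * ‖h₀‖ ^ (α - 1) * ‖w‖ := by
  have hpos : 0 < ‖h₀‖ := norm_pos_iff.2 hh₀
  have hsq : 0 < ‖h₀‖ ^ 2 := by positivity
  have hfun : (fun h : E => ‖h‖ ^ α) = (fun r : ℝ => r ^ (α / 2)) ∘ fun h : E => ‖h‖ ^ 2 := by
    funext h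
    simp only [Function.comp_apply]
    rw [← Real.rpow_natCast, ← Real.rpow_mul (norm_nonneg h)]
    congr 1
    push_cast
    ring
  have h1 : HasFDerivAt (fun h : E => ‖h‖ ^ 2) (2 • innerSL ℝ h₀) h₀ :=
    (hasStrictFDerivAt_norm_sq h₀).hasFDerivAt
  have h2 : HasDerivAt (fun r : ℝ => r ^ (α / 2)) (α / 2 * (‖h₀‖ ^ 2) ^ (α / 2 - 1)) (‖h₀‖ ^ 2) :=
    Real.hasDerivAt_rpow_const (Or.inl hsq.ne')
  have h3 := h2.comp_hasFDerivAt h₀ h1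
  rw [← hfun] at h3
  set c : ℝ := (‖h₀‖ ^ 2) ^ (α / 2 - 1) with hc
  have hc0 : 0 ≤ c := Real.rpow_nonneg hsq.le _
  have h4 : HasFDerivAt (fun h : E => ‖h‖ ^ α) ((α * c) • innerSL ℝ h₀) h₀ := by
    refine h3.congr_fderiv ?_
    ext w
    change (α / 2 * c) • ((2 : ℕ) • ⟪h₀, w⟫) = (α * c) • ⟪h₀, w⟫
    rw [smul_eq_mul, smul_eq_mul, nsmul_eq_mul, Nat.cast_ofNat]
    ring
  refine ⟨_, h4, fun w => ?_⟩
  have hr : c * ‖h₀‖ = ‖h₀‖ ^ (α - 1) := by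
    rw [hc, ← Real.rpow_natCast, ← Real.rpow_mul hpos.le, ← Real.rpow_add_one hpos.ne']
    congr 1
    push_cast
    ring
  change |(α * c) • ⟪h₀, w⟫| ≤ _
  rw [smul_eq_mul, abs_mul, abs_mul, abs_of_nonneg hα, abs_of_nonneg hc0]
  calc α * c * |⟪h₀, w⟫| ≤ α * c * (‖h₀‖ * ‖w‖) :=
        mul_le_mul_of_nonneg_left (abs_real_inner_le_norm _ _) (mul_nonneg hα hc0)
    _ = α * ‖h₀‖ ^ (α - 1) * ‖w‖ := by rw [← hr]; ring

end HolderTools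

/-! ## (3.6): the Hölder estimate by the maximum principle in the doubled variables -/

section Holder

variable {d : Type*} [Fintype d] [DecidableEq d]

variable {a b : ℝ} {u : ℝ → UnitAddTorus d → EuclideanSpace ℝ d}
  {f g : ℝ → UnitAddTorus d → EuclideanSpace ℝ d} {ν γ : ℝ}

/-- **Maximum principle for the weighted increments** (the core of De Rosa's Prop. 3.3): for a
smooth solution of `∂ₜf + (u·∇)f + ν(-Δ)^γ f = g` on `[a,b] × T^d` (`ν ≥ 0`, `0 < γ < 1`) with
`u` smooth, `‖Du‖ ≤ K`, `0 ≤ α < 1`, `[f(t₀)]_α ≤ H₀`, `[g(s)]_α ≤ H₁` for `s ∈ [t₀,t]` (Hölder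
constants of the lifts), and every `η > 0`: for `s ∈ [t₀,t]`, `y, h ∈ ℝ^d`, `‖e‖ ≤ 1`,
`e^{-αK(s-t₀)} ⟨e, f(s, y+h) - f(s, y)⟩ ≤ (H₀ + η + (s - t₀)(H₁ + η)) ‖h‖^α`.
[cite: Derosa2018, §3.1 Prop. 3.3 (3.6) (proof)] -/
theorem inner_increment_le_barrier_of_fracTransport (hab : a < b)
    (hu : IsSmoothSpaceTimeOn (Icc a b) u) (hf : IsSmoothSpaceTimeOn (Icc a b) f)
    (hν : 0 ≤ ν) (hγ0 : 0 < γ) (hγ1 : γ < 1)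
    (heq : ∀ s ∈ Icc a b, ∀ x, timeDerivWithin (Icc a b) f s x + convect (u s) (f s) x +
      ν • fracLaplacian γ (f s) x = g s x)
    {K : ℝ≥0} (hK : ∀ s ∈ Icc a b, ∀ x, ‖Torus.fderiv (u s) x‖ ≤ K)
    {t₀ t : ℝ} (ht₀ : t₀ ∈ Icc a b) (ht : t ∈ Icc a b) {α : ℝ≥0} (hα1 : α < 1) {H₀ H₁ : ℝ}
    (hH₀ : 0 ≤ H₀) (hH₁ : 0 ≤ H₁)
    (hf₀ : ∀ z₁ z₂ : EuclideanSpace ℝ d,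
      ‖f t₀ (proj z₁) - f t₀ (proj z₂)‖ ≤ H₀ * ‖z₁ - z₂‖ ^ (α : ℝ))
    (hg : ∀ s ∈ Icc t₀ t, ∀ z₁ z₂ : EuclideanSpace ℝ d,
      ‖g s (proj z₁) - g s (proj z₂)‖ ≤ H₁ * ‖z₁ - z₂‖ ^ (α : ℝ))
    {η : ℝ} (hη : 0 < η) {s : ℝ} (hs : s ∈ Icc t₀ t) (y h : EuclideanSpace ℝ d)
    {e : EuclideanSpace ℝ d} (he : ‖e‖ ≤ 1) :
    Real.exp (-(α * K * (s - t₀))) * ⟪e, f s (proj (y + h)) - f s (proj y)⟫ ≤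
      (H₀ + η + (s - t₀) * (H₁ + η)) * ‖h‖ ^ (α : ℝ) := by
  classical
  have hα0 : (0 : ℝ) ≤ α := α.2
  have hK0 : (0 : ℝ) ≤ K := K.2
  have hαK0 : (0 : ℝ) ≤ α * K := mul_nonneg hα0 hK0
  have hsub : Icc t₀ t ⊆ Icc a b := Icc_subset_Icc ht₀.1 ht.2
  -- the weight and the barrier
  set cw : ℝ → ℝ := fun σ => Real.exp (-(α * K * (σ - t₀))) with hcw
  set Bt : ℝ → ℝ := fun σ => H₀ + η + (σ - t₀) * (H₁ + η) with hBt
  have hcw_pos : ∀ σ, 0 < cw σ := fun σ => Real.exp_pos _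
  have hcw_le : ∀ σ, t₀ ≤ σ → cw σ ≤ 1 := fun σ hσ => by
    rw [hcw]; dsimp only
    rw [Real.exp_le_one_iff, neg_nonpos]
    exact mul_nonneg hαK0 (sub_nonneg.2 hσ)
  have hcw0 : cw t₀ = 1 := by simp [hcw]
  have hBt_ge : ∀ σ, t₀ ≤ σ → η ≤ Bt σ := fun σ hσ => by
    have : 0 ≤ (σ - t₀) * (H₁ + η) := mul_nonneg (sub_nonneg.2 hσ) (by linarith)
    simp only [hBt]; linarith
  have hBt0 : ∀ σ, t₀ ≤ σ → 0 ≤ Bt σ := fun σ hσ => hη.le.trans (hBt_ge σ hσ)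
  -- inner products against short vectors
  have hinner_le : ∀ {e' : EuclideanSpace ℝ d} (_ : ‖e'‖ ≤ 1) (v : EuclideanSpace ℝ d),
      ⟪e', v⟫ ≤ ‖v‖ := fun {e'} he' v =>
    calc ⟪e', v⟫ ≤ ‖e'‖ * ‖v‖ := real_inner_le_norm _ _
      _ ≤ 1 * ‖v‖ := mul_le_mul_of_nonneg_right he' (norm_nonneg _)
      _ = ‖v‖ := one_mul _
  have hcw_inner_le : ∀ {σ : ℝ} (_ : t₀ ≤ σ) {e' : EuclideanSpace ℝ d} (_ : ‖e'‖ ≤ 1)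
      (v : EuclideanSpace ℝ d), cw σ * ⟪e', v⟫ ≤ ‖v‖ := fun {σ} hσ {e'} he' v =>
    calc cw σ * ⟪e', v⟫ ≤ cw σ * |⟪e', v⟫| :=
          mul_le_mul_of_nonneg_left (le_abs_self _) (hcw_pos σ).le
      _ ≤ 1 * |⟪e', v⟫| := mul_le_mul_of_nonneg_right (hcw_le σ hσ) (abs_nonneg _)
      _ ≤ ‖v‖ := by
          rw [one_mul]
          exact (abs_real_inner_le_norm _ _).trans
            ((mul_le_mul_of_nonneg_right he' (norm_nonneg _)).trans (by rw [one_mul]))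
  by_contra hcon
  push Not at hcon
  -- Step 0: a uniform spatial Lipschitz constant for `f`
  obtain ⟨L, hL0, hL⟩ := exists_lipschitz_slice hab hf
  -- Step 1: small increments obey the claimed bound
  have h1α : 0 < 1 - (α : ℝ) := sub_pos.2 (by exact_mod_cast hα1)
  set ρ : ℝ := (η / (L + 1)) ^ (1 - (α : ℝ))⁻¹ with hρ
  have hηL : 0 < η / (L + 1) := div_pos hη (by linarith)
  have hρpos : 0 < ρ := Real.rpow_pos_of_pos hηL _
  have hρpow : ρ ^ (1 - (α : ℝ)) = η / (L + 1) := Real.rpow_inv_rpow hηL.le h1α.ne'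
  have hsmall : ∀ σ ∈ Icc t₀ t, ∀ (y' h' e' : EuclideanSpace ℝ d), ‖e'‖ ≤ 1 → ‖h'‖ ≤ ρ →
      cw σ * ⟪e', f σ (proj (y' + h')) - f σ (proj y')⟫ ≤ Bt σ * ‖h'‖ ^ (α : ℝ) := by
    intro σ hσ y' h' e' he' hh'
    have hδ : ‖f σ (proj (y' + h')) - f σ (proj y')‖ ≤ L * ‖h'‖ := by
      simpa [add_sub_cancel_left] using hL σ (hsub hσ) (y' + h') y'
    have hN0 : 0 ≤ ‖h'‖ ^ (α : ℝ) := Real.rpow_nonneg (norm_nonneg _) _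
    have hLη : L * ‖h'‖ ≤ η * ‖h'‖ ^ (α : ℝ) := by
      rcases eq_or_ne h' 0 with rfl | h0
      · rw [norm_zero, mul_zero]
        exact mul_nonneg hη.le (Real.rpow_nonneg le_rfl _)
      · have hpos : 0 < ‖h'‖ := norm_pos_iff.2 h0
        have hsplit : ‖h'‖ ^ (1 - (α : ℝ)) * ‖h'‖ ^ (α : ℝ) = ‖h'‖ := by
          rw [← Real.rpow_add hpos]; norm_num
        have hle1 : ‖h'‖ ^ (1 - (α : ℝ)) ≤ η / (L + 1) := by
          rw [← hρpow]
          exact Real.rpow_le_rpow (norm_nonneg _) hh' h1α.le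
        have hle2 : L * (η / (L + 1)) ≤ η := by
          rw [mul_div_assoc']
          rw [div_le_iff₀ (by linarith only [hL0])]
          linarith only [hη.le]
        calc L * ‖h'‖ = L * ‖h'‖ ^ (1 - (α : ℝ)) * ‖h'‖ ^ (α : ℝ) := by
              rw [mul_assoc, hsplit]
          _ ≤ L * (η / (L + 1)) * ‖h'‖ ^ (α : ℝ) :=
              mul_le_mul_of_nonneg_right (mul_le_mul_of_nonneg_left hle1 hL0) hN0
          _ ≤ η * ‖h'‖ ^ (α : ℝ) := mul_le_mul_of_nonneg_right hle2 hN0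
    calc cw σ * ⟪e', f σ (proj (y' + h')) - f σ (proj y')⟫
        ≤ ‖f σ (proj (y' + h')) - f σ (proj y')‖ := hcw_inner_le hσ.1 he' _
      _ ≤ L * ‖h'‖ := hδ
      _ ≤ η * ‖h'‖ ^ (α : ℝ) := hLη
      _ ≤ Bt σ * ‖h'‖ ^ (α : ℝ) := mul_le_mul_of_nonneg_right (hBt_ge σ hσ.1) hN0
  -- Step 2: the compact parameter set
  obtain ⟨R₀, hR₀pos, hR₀⟩ := exists_norm_repr_le d
  set cube : Set (EuclideanSpace ℝ d) :=
    (WithLp.toLp 2) '' (Set.pi univ fun _ : d => Icc (0 : ℝ) 1) with hcube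
  set An : Set (EuclideanSpace ℝ d) := {h' | ρ ≤ ‖h'‖} ∩ closedBall 0 R₀ with hAn
  set Kc : Set (ℝ × EuclideanSpace ℝ d × EuclideanSpace ℝ d × EuclideanSpace ℝ d) :=
    Icc t₀ t ×ˢ (cube ×ˢ (An ×ˢ closedBall (0 : EuclideanSpace ℝ d) 1)) with hKc
  have hAnc : IsCompact An :=
    (isCompact_closedBall _ _).inter_left (isClosed_le continuous_const continuous_norm)
  have hKcc : IsCompact Kc :=
    isCompact_Icc.prod (isCompact_toLp_image_pi_Icc.prod (hAnc.prod (isCompact_closedBall _ _)))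
  set Θ : ℝ × EuclideanSpace ℝ d × EuclideanSpace ℝ d × EuclideanSpace ℝ d → ℝ :=
    fun p => cw p.1 * ⟪p.2.2.2, f p.1 (proj (p.2.1 + p.2.2.1)) - f p.1 (proj p.2.1)⟫ -
      Bt p.1 * ‖p.2.2.1‖ ^ (α : ℝ) with hΘ
  have hmemKc : ∀ {σ : ℝ} (_ : σ ∈ Icc t₀ t) (z : UnitAddTorus d) {h' : EuclideanSpace ℝ d}
      (_ : ρ ≤ ‖h'‖) (_ : ‖h'‖ ≤ R₀) {e' : EuclideanSpace ℝ d} (_ : ‖e'‖ ≤ 1),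
      ((σ, repr z, h', e') : ℝ × EuclideanSpace ℝ d × EuclideanSpace ℝ d × EuclideanSpace ℝ d)
        ∈ Kc := by
    intro σ hσ z h' hρh hRh e' he'
    refine mk_mem_prod hσ (mk_mem_prod (repr_mem_toLp_image_pi_Icc z) (mk_mem_prod ⟨hρh, ?_⟩ ?_))
    · rwa [mem_closedBall, dist_zero_right]
    · rwa [mem_closedBall, dist_zero_right]
  have hΘc : ContinuousOn Θ Kc := by
    have hc := hf.continuousOn_stLift
    have h1 : ContinuousOn (fun p : ℝ × EuclideanSpace ℝ d × EuclideanSpace ℝ d × EuclideanSpace ℝ d =>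
        f p.1 (proj (p.2.1 + p.2.2.1))) Kc := by
      have h2 : Continuous fun p : ℝ × EuclideanSpace ℝ d × EuclideanSpace ℝ d × EuclideanSpace ℝ d =>
          ((p.1, p.2.1 + p.2.2.1) : ℝ × EuclideanSpace ℝ d) := by fun_prop
      refine hc.comp h2.continuousOn fun p hp => ?_
      exact mk_mem_prod (hsub (mem_prod.1 hp).1) (mem_univ _)
    have h2 : ContinuousOn (fun p : ℝ × EuclideanSpace ℝ d × EuclideanSpace ℝ d × EuclideanSpace ℝ d =>
        f p.1 (proj p.2.1)) Kc := by
      have h3 : Continuous fun p : ℝ × EuclideanSpace ℝ d × EuclideanSpace ℝ d × EuclideanSpace ℝ d =>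
          ((p.1, p.2.1) : ℝ × EuclideanSpace ℝ d) := by fun_prop
      refine hc.comp h3.continuousOn fun p hp => ?_
      exact mk_mem_prod (hsub (mem_prod.1 hp).1) (mem_univ _)
    have h3 : ContinuousOn (fun p : ℝ × EuclideanSpace ℝ d × EuclideanSpace ℝ d × EuclideanSpace ℝ d =>
        p.2.2.2) Kc := (continuous_snd.comp (continuous_snd.comp continuous_snd)).continuousOn
    have h4 : Continuous fun p : ℝ × EuclideanSpace ℝ d × EuclideanSpace ℝ d × EuclideanSpace ℝ d =>
        cw p.1 := by
      simp only [hcw]; fun_prop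
    have h5 : Continuous fun p : ℝ × EuclideanSpace ℝ d × EuclideanSpace ℝ d × EuclideanSpace ℝ d =>
        Bt p.1 * ‖p.2.2.1‖ ^ (α : ℝ) := by
      refine Continuous.mul (by simp only [hBt]; fun_prop) ?_
      exact (continuous_norm.comp (continuous_fst.comp (continuous_snd.comp continuous_snd))).rpow_const
        fun _ => Or.inr hα0
    exact ((h4.continuousOn.mul (h3.inner (h1.sub h2))).sub h5.continuousOn)
  -- Step 3: every parameter is dominated by the compact set (or is harmless)
  have hdom : ∀ σ ∈ Icc t₀ t, ∀ (y' h' e' : EuclideanSpace ℝ d), ‖e'‖ ≤ 1 →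
      Θ (σ, y', h', e') ≤ 0 ∨ ∃ p ∈ Kc, Θ (σ, y', h', e') ≤ Θ p := by
    intro σ hσ y' h' e' he'
    obtain ⟨h'', hproj, hR, hle⟩ := exists_short_representative hR₀ h'
    have e1 : f σ (proj (y' + h')) = f σ (proj (repr (proj y') + h'')) := by
      rw [proj_add, proj_add, proj_repr, hproj]
    have e2 : f σ (proj y') = f σ (proj (repr (proj y'))) := by rw [proj_repr]
    have hle' : Θ (σ, y', h', e') ≤ Θ (σ, repr (proj y'), h'', e') := by
      simp only [hΘ]
      rw [e1, e2]
      have : Bt σ * ‖h''‖ ^ (α : ℝ) ≤ Bt σ * ‖h'‖ ^ (α : ℝ) :=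
        mul_le_mul_of_nonneg_left (Real.rpow_le_rpow (norm_nonneg _) hle hα0) (hBt0 σ hσ.1)
      linarith
    by_cases hρh : ρ ≤ ‖h''‖
    · exact Or.inr ⟨_, hmemKc hσ (proj y') hρh hR he', hle'⟩
    · left
      have hsm := hsmall σ hσ (repr (proj y')) h'' e' he' (le_of_lt (not_le.1 hρh))
      have : Θ (σ, repr (proj y'), h'', e') ≤ 0 := by
        simp only [hΘ]; linarith
      linarith
  -- the violating parameter gives a positive value, hence a positive maximum on `Kc`
  have hΘpos : 0 < Θ (s, y, h, e) := by simp only [hΘ]; linarith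
  obtain ⟨p₁, hp₁K, hp₁⟩ : ∃ p ∈ Kc, Θ (s, y, h, e) ≤ Θ p := by
    rcases hdom s hs y h e he with h0 | h0
    · exact absurd h0 (not_le.2 hΘpos)
    · exact h0
  obtain ⟨p, hpK, hpmax⟩ := hKcc.exists_isMaxOn ⟨p₁, hp₁K⟩ hΘc
  have hm_pos : 0 < Θ p := lt_of_lt_of_le (hΘpos.trans_le hp₁) (hpmax hp₁K)
  have hG1 : ∀ σ ∈ Icc t₀ t, ∀ (y' h' e' : EuclideanSpace ℝ d), ‖e'‖ ≤ 1 →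
      Θ (σ, y', h', e') ≤ Θ p := by
    intro σ hσ y' h' e' he'
    rcases hdom σ hσ y' h' e' he' with h0 | ⟨p', hp'K, hp'⟩
    · exact h0.trans hm_pos.le
    · exact hp'.trans (hpmax hp'K)
  -- name the maximiser
  set sS : ℝ := p.1 with hsS
  set yS : EuclideanSpace ℝ d := p.2.1 with hyS
  set hS : EuclideanSpace ℝ d := p.2.2.1 with hhS
  set eS : EuclideanSpace ℝ d := p.2.2.2 with heS
  have hp_eq : p = (sS, yS, hS, eS) := by simp [hsS, hyS, hhS, heS]
  have hsS_mem : sS ∈ Icc t₀ t := by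
    have := (mem_prod.1 hpK).1; simpa [hsS] using this
  have hhS_mem : hS ∈ An := (mem_prod.1 (mem_prod.1 (mem_prod.1 hpK).2).2).1
  have heS_le : ‖eS‖ ≤ 1 := by
    have h0 := (mem_prod.1 (mem_prod.1 (mem_prod.1 hpK).2).2).2
    rwa [mem_closedBall, dist_zero_right] at h0
  have hρS : ρ ≤ ‖hS‖ := hhS_mem.1
  have hhS_pos : 0 < ‖hS‖ := hρpos.trans_le hρS
  have hhS_ne : hS ≠ 0 := norm_pos_iff.1 hhS_pos
  have hsSab : sS ∈ Icc a b := hsub hsS_mem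
  set P : UnitAddTorus d := proj yS with hP
  set Q : UnitAddTorus d := proj (yS + hS) with hQ
  have hQP : Q = P + proj hS := by rw [hQ, hP, proj_add]
  set N : ℝ := ‖hS‖ ^ (α : ℝ) with hN
  have hNpos : 0 < N := Real.rpow_pos_of_pos hhS_pos _
  set X : ℝ := cw sS with hX
  have hXpos : 0 < X := hcw_pos sS
  have hXle : X ≤ 1 := hcw_le sS hsS_mem.1
  set B : ℝ := Bt sS with hB
  have hB0 : 0 ≤ B := hBt0 sS hsS_mem.1
  have hΘp : Θ p = X * ⟪eS, f sS Q - f sS P⟫ - B * N := by rw [hp_eq]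
  set D : ℝ := ⟪eS, f sS Q - f sS P⟫ with hD
  have hXD : B * N < X * D := by
    have := hm_pos; rw [hΘp] at this; linarith
  -- (i) the maximiser is not at the initial time
  have hlt : t₀ < sS := by
    rcases eq_or_lt_of_le hsS_mem.1 with h0 | h0
    · exfalso
      have h1 : X * D ≤ H₀ * N := by
        have h2 : X = 1 := by rw [hX, ← h0, hcw0]
        rw [h2, one_mul, hD]
        refine (hinner_le heS_le _).trans ?_
        have h3 := hf₀ (yS + hS) yS
        rw [add_sub_cancel_left] at h3
        rw [hQ, hP, ← h0]
        exact h3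
      have h2 : B = H₀ + η := by rw [hB, ← h0]; simp [hBt]
      rw [h2] at hXD
      have h3 : η * N < 0 := by linarith only [h1, hXD]
      exact absurd h3 (not_lt.2 (mul_pos hη hNpos).le)
    · exact h0
  have hfS : IsSmooth (f sS) := hf.isSmooth_slice hsSab
  have hfS1 : IsContDiff 1 (f sS) := hfS.isContDiff (by simp)
  have hdiff : Differentiable ℝ (lift (f sS)) := hfS1.differentiable one_ne_zero
  -- (ii) translating base and tip together: `⟨eS, (Df(Q) - Df(P)) w⟩ = 0`
  have hTrans : ∀ w, ⟪eS, Torus.fderiv (f sS) Q w⟫ = ⟪eS, Torus.fderiv (f sS) P w⟫ := by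
    intro w
    set Φy : EuclideanSpace ℝ d → ℝ := fun τ =>
      ⟪eS, lift (f sS) (yS + hS + τ) - lift (f sS) (yS + τ)⟫ with hΦy
    have hmax : IsLocalMax Φy 0 := by
      refine Filter.Eventually.of_forall fun τ => ?_
      have h1 := hG1 sS hsS_mem (yS + τ) hS eS heS_le
      rw [hΘp] at h1
      have h2 : Θ (sS, yS + τ, hS, eS) =
          X * ⟪eS, f sS (proj (yS + τ + hS)) - f sS (proj (yS + τ))⟫ - B * N := rfl
      rw [h2] at h1
      have h3 : ⟪eS, f sS (proj (yS + τ + hS)) - f sS (proj (yS + τ))⟫ ≤ D :=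
        le_of_mul_le_mul_left (by linarith only [h1]) hXpos
      have e1 : Φy τ = ⟪eS, f sS (proj (yS + τ + hS)) - f sS (proj (yS + τ))⟫ := by
        simp only [hΦy, lift_apply]
        rw [add_right_comm]
      have e2 : Φy 0 = D := by
        simp only [hΦy, lift_apply, add_zero]
        rfl
      rw [e1, e2]
      exact h3
    have hd1 : HasFDerivAt (fun τ : EuclideanSpace ℝ d => lift (f sS) (yS + hS + τ))
        (_root_.fderiv ℝ (lift (f sS)) (yS + hS + 0)) 0 :=
      ((hdiff _).hasFDerivAt).comp (0 : EuclideanSpace ℝ d)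
        ((hasFDerivAt_id (0 : EuclideanSpace ℝ d)).const_add (yS + hS)) |>.congr_fderiv (by simp)
    have hd2 : HasFDerivAt (fun τ : EuclideanSpace ℝ d => lift (f sS) (yS + τ))
        (_root_.fderiv ℝ (lift (f sS)) (yS + 0)) 0 :=
      ((hdiff _).hasFDerivAt).comp (0 : EuclideanSpace ℝ d)
        ((hasFDerivAt_id (0 : EuclideanSpace ℝ d)).const_add yS) |>.congr_fderiv (by simp)
    have hd : HasFDerivAt Φy ((innerSL ℝ eS).comp
        (_root_.fderiv ℝ (lift (f sS)) (yS + hS + 0) - _root_.fderiv ℝ (lift (f sS)) (yS + 0))) 0 :=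
      (innerSL ℝ eS).hasFDerivAt.comp (0 : EuclideanSpace ℝ d) (hd1.sub hd2)
    have h0 := hmax.hasFDerivAt_eq_zero hd
    have h1 := DFunLike.congr_fun h0 w
    simp only [add_zero, fderiv_lift] at h1
    have h2 : ⟪eS, Torus.fderiv (f sS) Q w⟫ - ⟪eS, Torus.fderiv (f sS) P w⟫ = 0 := by
      simpa [hQ, hP, proj_add, inner_sub_right] using h1
    linarith only [h2]
  -- (iii) moving the tip alone: `X ⟨eS, Df(Q) w⟩ = B N'(w)` with `|N' w| ≤ α‖hS‖^{α-1}‖w‖`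
  obtain ⟨N', hN', hN'le⟩ := exists_hasFDerivAt_norm_rpow (E := EuclideanSpace ℝ d) hα0 hhS_ne
  have hTip : ∀ w, X * ⟪eS, Torus.fderiv (f sS) Q w⟫ = B * N' w := by
    intro w
    set Φh : EuclideanSpace ℝ d → ℝ := fun τ =>
      X * ⟪eS, lift (f sS) (yS + hS + τ) - f sS P⟫ - B * ‖hS + τ‖ ^ (α : ℝ) with hΦh
    have hmax : IsLocalMax Φh 0 := by
      refine Filter.Eventually.of_forall fun τ => ?_
      have h1 := hG1 sS hsS_mem yS (hS + τ) eS heS_le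
      rw [hΘp] at h1
      have e1 : Φh τ = Θ (sS, yS, hS + τ, eS) := by
        show X * ⟪eS, f sS (proj (yS + hS + τ)) - f sS P⟫ - B * ‖hS + τ‖ ^ (α : ℝ) =
          cw sS * ⟪eS, f sS (proj (yS + (hS + τ))) - f sS (proj yS)⟫ - Bt sS * ‖hS + τ‖ ^ (α : ℝ)
        rw [add_assoc]
      have e2 : Φh 0 = X * D - B * N := by
        show X * ⟪eS, f sS (proj (yS + hS + 0)) - f sS P⟫ - B * ‖hS + 0‖ ^ (α : ℝ) = X * D - B * N
        rw [add_zero, add_zero]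
      rw [e1, e2]
      exact h1
    have hd1 : HasFDerivAt (fun τ : EuclideanSpace ℝ d => lift (f sS) (yS + hS + τ))
        (_root_.fderiv ℝ (lift (f sS)) (yS + hS + 0)) 0 :=
      ((hdiff _).hasFDerivAt).comp (0 : EuclideanSpace ℝ d)
        ((hasFDerivAt_id (0 : EuclideanSpace ℝ d)).const_add (yS + hS)) |>.congr_fderiv (by simp)
    have hd2 : HasFDerivAt (fun τ : EuclideanSpace ℝ d => lift (f sS) (yS + hS + τ) - f sS P)
        (_root_.fderiv ℝ (lift (f sS)) (yS + hS + 0)) 0 := by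
      simpa using hd1.sub_const (f sS P)
    have hd3 : HasFDerivAt (fun τ : EuclideanSpace ℝ d => X * ⟪eS, lift (f sS) (yS + hS + τ) - f sS P⟫)
        (X • (innerSL ℝ eS).comp (_root_.fderiv ℝ (lift (f sS)) (yS + hS + 0))) 0 :=
      ((innerSL ℝ eS).hasFDerivAt.comp (0 : EuclideanSpace ℝ d) hd2).const_mul X |>.congr_fderiv
        (by ext w; simp [smul_eq_mul])
    have hN'0 : HasFDerivAt (fun h' : EuclideanSpace ℝ d => ‖h'‖ ^ (α : ℝ)) N' (hS + 0) := by
      rw [add_zero]; exact hN'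
    have hd4 : HasFDerivAt (fun τ : EuclideanSpace ℝ d => ‖hS + τ‖ ^ (α : ℝ)) N' 0 := by
      have h := hN'0.comp (0 : EuclideanSpace ℝ d) ((hasFDerivAt_id (0 : EuclideanSpace ℝ d)).const_add hS)
      simpa [Function.comp_def] using h
    have hd : HasFDerivAt Φh (X • (innerSL ℝ eS).comp (_root_.fderiv ℝ (lift (f sS)) (yS + hS + 0)) -
        B • N') 0 := hd3.sub (hd4.const_smul B)
    have h0 := hmax.hasFDerivAt_eq_zero hd
    have h1 := DFunLike.congr_fun h0 w
    simp only [add_zero, fderiv_lift] at h1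
    have h2 : X * ⟪eS, Torus.fderiv (f sS) Q w⟫ - B * N' w = 0 := by
      simpa [hQ, proj_add, smul_eq_mul] using h1
    linarith only [h2]
  -- (iv) the one-sided time derivative at the maximiser
  have hψmax : ∀ σ ∈ Icc t₀ sS,
      cw σ * ⟪eS, f σ Q - f σ P⟫ - Bt σ * N ≤ X * D - B * N := by
    intro σ hσ
    have hσt : σ ∈ Icc t₀ t := ⟨hσ.1, hσ.2.trans hsS_mem.2⟩
    have h1 := hG1 σ hσt yS hS eS heS_le
    rw [hΘp] at h1
    exact h1
  have hcw_d : HasDerivAt cw (X * (-(α * K))) sS := by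
    have h1 : HasDerivAt (fun σ : ℝ => -((α : ℝ) * K) * (σ - t₀)) (-(α * K)) sS := by
      simpa using ((hasDerivAt_id sS).sub_const t₀).const_mul (-((α : ℝ) * K))
    have h2 := h1.exp
    have hfun : cw = fun σ => Real.exp (-((α : ℝ) * K) * (σ - t₀)) := by
      funext σ; simp only [hcw, neg_mul]
    have hXe : X = Real.exp (-((α : ℝ) * K) * (sS - t₀)) := by simp only [hX, hcw, neg_mul]
    rw [hfun, hXe]
    exact h2
  have hslice : HasDerivWithinAt (fun σ => ⟪eS, f σ Q - f σ P⟫)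
      ⟪eS, timeDerivWithin (Icc a b) f sS Q - timeDerivWithin (Icc a b) f sS P⟫ (Icc a b) sS := by
    have h1 := (hf.hasDerivWithinAt_slice hsSab Q).sub (hf.hasDerivWithinAt_slice hsSab P)
    have h := ((innerSL ℝ eS).hasFDerivAt).comp_hasDerivWithinAt sS h1
    simpa [Function.comp_def] using h
  have hBt_d : HasDerivWithinAt (fun σ => Bt σ * N) ((H₁ + η) * N) (Icc a b) sS := by
    have h4 : HasDerivAt (fun σ : ℝ => (H₀ + η + (σ - t₀) * (H₁ + η)) * N) ((H₁ + η) * N) sS := by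
      have h5 := (((hasDerivAt_id sS).sub_const t₀).mul_const (H₁ + η)).const_add (H₀ + η)
      simpa using h5.mul_const N
    exact h4.hasDerivWithinAt
  have hψd : HasDerivWithinAt (fun σ => cw σ * ⟪eS, f σ Q - f σ P⟫ - Bt σ * N)
      (X * (-(α * K)) * D + X * ⟪eS, timeDerivWithin (Icc a b) f sS Q - timeDerivWithin (Icc a b) f sS P⟫
        - (H₁ + η) * N) (Icc a b) sS :=
    (hcw_d.hasDerivWithinAt.mul hslice).sub hBt_d
  have htime : 0 ≤ X * (-(α * K)) * D +
      X * ⟪eS, timeDerivWithin (Icc a b) f sS Q - timeDerivWithin (Icc a b) f sS P⟫ - (H₁ + η) * N :=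
    deriv_nonneg_of_isMaxOn_Icc hlt (Icc_subset_Icc ht₀.1 hsSab.2) hψd hψmax
  -- (v) the dissipation of the increment at its maximum point
  set φ : UnitAddTorus d → EuclideanSpace ℝ d := fun x => f sS (x + proj hS) - f sS x with hφ
  have hT : IsSmooth (fun x => f sS (x + proj hS)) := hfS.comp_add_right _
  have hφs : IsSmooth φ := hT.sub hfS
  have hφmax : ∀ x, ⟪eS, φ x⟫ ≤ ⟪eS, φ P⟫ := by
    intro x
    obtain ⟨y', rfl⟩ := proj_surjective x
    have h1 := hG1 sS hsS_mem y' hS eS heS_le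
    rw [hΘp] at h1
    have h2 : Θ (sS, y', hS, eS) = X * ⟪eS, f sS (proj (y' + hS)) - f sS (proj y')⟫ - B * N := rfl
    rw [h2] at h1
    have h3 : ⟪eS, f sS (proj (y' + hS)) - f sS (proj y')⟫ ≤ ⟪eS, f sS Q - f sS P⟫ :=
      le_of_mul_le_mul_left (by linarith) hXpos
    simp only [hφ]
    rw [← proj_add, ← hQP]
    exact h3
  have hdiss : 0 ≤ ⟪eS, fracLaplacian γ (f sS) Q - fracLaplacian γ (f sS) P⟫ := by
    have h1 := inner_fracLaplacian_nonneg_of_forall_le hγ0 hγ1 hφs hφmax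
    have h2 : fracLaplacian γ φ = fun x => fracLaplacian γ (f sS) (x + proj hS) - fracLaplacian γ (f sS) x := by
      simp only [hφ]
      rw [fracLaplacian_sub hγ0.le hT hfS, fracLaplacian_comp_add_right]
    rw [h2] at h1
    simpa [hQP] using h1
  -- (vi) the advection terms
  have hLipu : LipschitzWith K (lift (u sS)) :=
    lipschitzWith_lift_of_norm_fderiv_le ((hu.isSmooth_slice hsSab).isContDiff (by simp)) (hK sS hsSab)
  have hδu : ‖u sS Q - u sS P‖ ≤ K * ‖hS‖ := by
    have h1 := hLipu.norm_sub_le (yS + hS) yS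
    rw [add_sub_cancel_left] at h1
    simpa [hQ, hP, lift_apply] using h1
  have hadv_eq : ⟪eS, convect (u sS) (f sS) Q⟫ - ⟪eS, convect (u sS) (f sS) P⟫ =
      ⟪eS, Torus.fderiv (f sS) Q (u sS Q - u sS P)⟫ := by
    simp only [convect]
    rw [← hTrans (u sS P), map_sub, inner_sub_right]
  have hadv : -(α * K * (B * N)) ≤
      X * (⟪eS, convect (u sS) (f sS) Q⟫ - ⟪eS, convect (u sS) (f sS) P⟫) := by
    rw [hadv_eq, hTip]
    have h1 : |N' (u sS Q - u sS P)| ≤ α * K * N := by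
      refine (hN'le _).trans ?_
      have h2 : ‖hS‖ ^ ((α : ℝ) - 1) * ‖hS‖ = N := by
        rw [hN, ← Real.rpow_add_one hhS_pos.ne']; norm_num
      calc (α : ℝ) * ‖hS‖ ^ ((α : ℝ) - 1) * ‖u sS Q - u sS P‖
          ≤ α * ‖hS‖ ^ ((α : ℝ) - 1) * (K * ‖hS‖) :=
            mul_le_mul_of_nonneg_left hδu (mul_nonneg hα0 (Real.rpow_nonneg (norm_nonneg _) _))
        _ = α * K * N := by rw [← h2]; ring
    have h3 : -(α * K * N) ≤ N' (u sS Q - u sS P) := by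
      have h4 := neg_abs_le (N' (u sS Q - u sS P))
      linarith only [h1, h4]
    have h4 : B * (-(α * K * N)) ≤ B * N' (u sS Q - u sS P) := mul_le_mul_of_nonneg_left h3 hB0
    have h5 : -((α : ℝ) * K * (B * N)) = B * (-(α * K * N)) := by ring
    rw [h5]
    exact h4
  -- (vii) the equation at `Q` and at `P`
  have heqQ := congrArg (fun v => ⟪eS, v⟫) (heq sS hsSab Q)
  have heqP := congrArg (fun v => ⟪eS, v⟫) (heq sS hsSab P)
  simp only [inner_add_right, real_inner_smul_right] at heqQ heqP
  have hgup : X * (⟪eS, g sS Q⟫ - ⟪eS, g sS P⟫) ≤ H₁ * N := by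
    rw [← inner_sub_right]
    refine (hcw_inner_le hsS_mem.1 heS_le _).trans ?_
    have h1 := hg sS hsS_mem (yS + hS) yS
    rw [add_sub_cancel_left] at h1
    simpa [hQ, hP, hN] using h1
  have hDt : ⟪eS, timeDerivWithin (Icc a b) f sS Q - timeDerivWithin (Icc a b) f sS P⟫ =
      ⟪eS, timeDerivWithin (Icc a b) f sS Q⟫ - ⟪eS, timeDerivWithin (Icc a b) f sS P⟫ :=
    inner_sub_right _ _ _
  have hL2 : ⟪eS, fracLaplacian γ (f sS) Q - fracLaplacian γ (f sS) P⟫ =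
      ⟪eS, fracLaplacian γ (f sS) Q⟫ - ⟪eS, fracLaplacian γ (f sS) P⟫ := inner_sub_right _ _ _
  rw [hDt] at htime
  rw [hL2] at hdiss
  have hαK_le : α * K * (B * N) ≤ α * K * (X * D) := mul_le_mul_of_nonneg_left hXD.le hαK0
  have hνX : 0 ≤ ν * X * (⟪eS, fracLaplacian γ (f sS) Q⟫ - ⟪eS, fracLaplacian γ (f sS) P⟫) :=
    mul_nonneg (mul_nonneg hν hXpos.le) hdiss
  have hXeq : X * (⟪eS, g sS Q⟫ - ⟪eS, g sS P⟫) =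
      X * (⟪eS, timeDerivWithin (Icc a b) f sS Q⟫ - ⟪eS, timeDerivWithin (Icc a b) f sS P⟫) +
      X * (⟪eS, convect (u sS) (f sS) Q⟫ - ⟪eS, convect (u sS) (f sS) P⟫) +
      ν * X * (⟪eS, fracLaplacian γ (f sS) Q⟫ - ⟪eS, fracLaplacian γ (f sS) P⟫) := by
    rw [← heqQ, ← heqP]; ring
  have hfinal : η * N ≤ 0 := by linarith only [hXeq, htime, hadv, hνX, hgup, hαK_le]
  exact absurd hfinal (not_le.2 (mul_pos hη hNpos))

/-- **Pointwise Hölder transport–diffusion bound** (De Rosa 2019, Prop. 3.3 (3.6), real form):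
with `‖Du‖ ≤ K` on `[a,b] × T^d`, `0 ≤ α < 1`, if `f(t₀)` is `α`-Hölder with constant `H₀` and
the `g(s)`, `s ∈ [t₀,t]`, are `α`-Hölder with constant `H₁` (on the lifts), then for `t₀ ≤ t`
`‖f(t, y₁) - f(t, y₂)‖ ≤ e^{αK(t-t₀)} (H₀ + (t - t₀) H₁) ‖y₁ - y₂‖^α`.
[cite: Derosa2018, §3.1 Prop. 3.3 (3.6)] -/
theorem norm_sub_fracTransport_le (hab : a < b)
    (hu : IsSmoothSpaceTimeOn (Icc a b) u) (hf : IsSmoothSpaceTimeOn (Icc a b) f)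
    (hν : 0 ≤ ν) (hγ0 : 0 < γ) (hγ1 : γ < 1)
    (heq : ∀ s ∈ Icc a b, ∀ x, timeDerivWithin (Icc a b) f s x + convect (u s) (f s) x +
      ν • fracLaplacian γ (f s) x = g s x)
    {K : ℝ≥0} (hK : ∀ s ∈ Icc a b, ∀ x, ‖Torus.fderiv (u s) x‖ ≤ K)
    {t₀ t : ℝ} (ht₀ : t₀ ∈ Icc a b) (ht : t ∈ Icc a b) (ht₀t : t₀ ≤ t) {α : ℝ≥0} (hα1 : α < 1)
    {H₀ H₁ : ℝ} (hH₀ : 0 ≤ H₀) (hH₁ : 0 ≤ H₁)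
    (hf₀ : ∀ z₁ z₂ : EuclideanSpace ℝ d,
      ‖f t₀ (proj z₁) - f t₀ (proj z₂)‖ ≤ H₀ * ‖z₁ - z₂‖ ^ (α : ℝ))
    (hg : ∀ s ∈ Icc t₀ t, ∀ z₁ z₂ : EuclideanSpace ℝ d,
      ‖g s (proj z₁) - g s (proj z₂)‖ ≤ H₁ * ‖z₁ - z₂‖ ^ (α : ℝ))
    (y₁ y₂ : EuclideanSpace ℝ d) :
    ‖f t (proj y₁) - f t (proj y₂)‖ ≤
      Real.exp (α * K * (t - t₀)) * (H₀ + (t - t₀) * H₁) * ‖y₁ - y₂‖ ^ (α : ℝ) := by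
  have htt : t ∈ Icc t₀ t := ⟨ht₀t, le_rfl⟩
  set Xi : ℝ := Real.exp (α * K * (t - t₀)) with hXi
  set Dn : ℝ := ‖y₁ - y₂‖ ^ (α : ℝ) with hDn
  have hXi : Real.exp (-(α * K * (t - t₀))) * Xi = 1 := by
    rw [hXi, ← Real.exp_add]; simp
  have hXipos : 0 < Xi := Real.exp_pos _
  have hDn0 : 0 ≤ Dn := Real.rpow_nonneg (norm_nonneg _) _
  have hT0 : 0 ≤ t - t₀ := sub_nonneg.2 ht₀t
  -- the estimate for every `η > 0`
  have key : ∀ η : ℝ, 0 < η →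
      ‖f t (proj y₁) - f t (proj y₂)‖ ≤ Xi * (H₀ + η + (t - t₀) * (H₁ + η)) * Dn := by
    intro η hη
    set v : EuclideanSpace ℝ d := f t (proj y₁) - f t (proj y₂) with hv
    have hy : y₂ + (y₁ - y₂) = y₁ := add_sub_cancel y₂ y₁
    by_cases h0 : v = 0
    · rw [h0, norm_zero]
      exact mul_nonneg (mul_nonneg hXipos.le (by positivity)) hDn0
    · set e : EuclideanSpace ℝ d := ‖v‖⁻¹ • v with he
      have hn : 0 < ‖v‖ := norm_pos_iff.2 h0
      have he1 : ‖e‖ ≤ 1 := by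
        rw [he, norm_smul, norm_inv, norm_norm, inv_mul_cancel₀ hn.ne']
      have hinner : ⟪e, v⟫ = ‖v‖ := by
        rw [he, real_inner_smul_left, real_inner_self_eq_norm_sq, pow_two, ← mul_assoc,
          inv_mul_cancel₀ hn.ne', one_mul]
      have h := inner_increment_le_barrier_of_fracTransport hab hu hf hν hγ0 hγ1 heq hK ht₀ ht hα1
        hH₀ hH₁ hf₀ hg hη htt y₂ (y₁ - y₂) he1
      rw [hy, ← hv, hinner] at h
      have h2 := mul_le_mul_of_nonneg_left h hXipos.le
      calc ‖v‖ = Xi * (Real.exp (-(α * K * (t - t₀))) * ‖v‖) := by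
            rw [← mul_assoc, mul_comm Xi, hXi, one_mul]
        _ ≤ Xi * ((H₀ + η + (t - t₀) * (H₁ + η)) * Dn) := h2
        _ = Xi * (H₀ + η + (t - t₀) * (H₁ + η)) * Dn := by ring
  refine le_of_forall_pos_le_add fun ε hε => ?_
  have h1 : 0 < Xi * (1 + (t - t₀)) * (Dn + 1) := by positivity
  set η : ℝ := ε / (Xi * (1 + (t - t₀)) * (Dn + 1)) with hη
  have hηpos : 0 < η := div_pos hε h1
  have h := key η hηpos
  have h2 : Xi * (H₀ + η + (t - t₀) * (H₁ + η)) * Dn =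
      Xi * (H₀ + (t - t₀) * H₁) * Dn + Xi * (1 + (t - t₀)) * Dn * η := by ring
  have h3 : Xi * (1 + (t - t₀)) * Dn * η ≤ ε := by
    have h4 : Xi * (1 + (t - t₀)) * Dn * η = ε * (Dn / (Dn + 1)) := by
      rw [hη]; field_simp
    rw [h4]
    have h5 : Dn / (Dn + 1) ≤ 1 := by
      rw [div_le_one (by linarith)]; linarith
    nlinarith
  linarith

/-- **Hölder transport–diffusion estimate** (De Rosa 2019, Prop. 3.3 (3.6), sharp form; the
fractional twin of BDSV (B.2), `Torus.eHolderNorm_transport_le`): for a smooth solution of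
`∂ₜf + (u·∇)f + ν(-Δ)^γ f = g` on `[a,b] × T^d` (`ν ≥ 0`, `0 < γ < 1`) with `‖Du‖ ≤ K`,
`0 ≤ α < 1` and `t₀ ≤ t`,
`[f(t)]_α ≤ e^{αK(t-t₀)} ([f(t₀)]_α + (t - t₀) sup_{s ∈ [t₀,t]} [g(s)]_α)` (Hölder seminorms of
the periodic lifts; for `(t - t₀) K ≤ 1` the factor is at most `e^α`, De Rosa's constant).
[cite: Derosa2018, §3.1 Prop. 3.3 (3.6)] -/
theorem eHolderNorm_fracTransport_le (hab : a < b)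
    (hu : IsSmoothSpaceTimeOn (Icc a b) u) (hf : IsSmoothSpaceTimeOn (Icc a b) f)
    (hν : 0 ≤ ν) (hγ0 : 0 < γ) (hγ1 : γ < 1)
    (heq : ∀ s ∈ Icc a b, ∀ x, timeDerivWithin (Icc a b) f s x + convect (u s) (f s) x +
      ν • fracLaplacian γ (f s) x = g s x)
    {K : ℝ≥0} (hK : ∀ s ∈ Icc a b, ∀ x, ‖Torus.fderiv (u s) x‖ ≤ K)
    {t₀ t : ℝ} (ht₀ : t₀ ∈ Icc a b) (ht : t ∈ Icc a b) (ht₀t : t₀ ≤ t) {α : ℝ≥0} (hα1 : α < 1) :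
    eHolderNorm α (lift (f t)) ≤ ENNReal.ofReal (Real.exp (α * K * (t - t₀))) *
      (eHolderNorm α (lift (f t₀)) +
        ENNReal.ofReal (t - t₀) * ⨆ s ∈ Icc t₀ t, eHolderNorm α (lift (g s))) := by
  set Hf := eHolderNorm α (lift (f t₀)) with hHf
  set Hg := ⨆ s ∈ Icc t₀ t, eHolderNorm α (lift (g s)) with hHg
  set Xi : ℝ := Real.exp (α * K * (t - t₀)) with hXi
  have hX0 : 0 < Xi := Real.exp_pos _
  have hXne : ENNReal.ofReal Xi ≠ 0 := by
    rw [Ne, ENNReal.ofReal_eq_zero, not_le]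
    exact hX0
  by_cases hfT : Hf = ⊤
  · rw [hfT, top_add, ENNReal.mul_top hXne]
    exact le_top
  rcases eq_or_lt_of_le ht₀t with rfl | htt
  · have h1 : Xi = 1 := by
      rw [hXi, sub_self, mul_zero, Real.exp_zero]
    rw [h1, ENNReal.ofReal_one, one_mul, sub_self, ENNReal.ofReal_zero, zero_mul, add_zero]
  by_cases hgT : Hg = ⊤
  · have hpos : ENNReal.ofReal (t - t₀) ≠ 0 := by
      rw [Ne, ENNReal.ofReal_eq_zero, not_le, sub_pos]
      exact htt
    rw [hgT, ENNReal.mul_top hpos, add_top, ENNReal.mul_top hXne]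
    exact le_top
  -- real bounds
  have hf₀ : ∀ z₁ z₂ : EuclideanSpace ℝ d,
      ‖f t₀ (proj z₁) - f t₀ (proj z₂)‖ ≤ Hf.toReal * ‖z₁ - z₂‖ ^ (α : ℝ) :=
    fun z₁ z₂ => norm_sub_le_of_eHolderNorm_le (φ := lift (f t₀)) ENNReal.toReal_nonneg
      (by rw [ENNReal.ofReal_toReal hfT]) z₁ z₂
  have hg' : ∀ s ∈ Icc t₀ t, ∀ z₁ z₂ : EuclideanSpace ℝ d,
      ‖g s (proj z₁) - g s (proj z₂)‖ ≤ Hg.toReal * ‖z₁ - z₂‖ ^ (α : ℝ) :=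
    fun s hs z₁ z₂ => norm_sub_le_of_eHolderNorm_le (φ := lift (g s)) ENNReal.toReal_nonneg
      (by
        rw [ENNReal.ofReal_toReal hgT]
        exact le_iSup₂ (f := fun s _ => eHolderNorm α (lift (g s))) s hs) z₁ z₂
  have hpt := norm_sub_fracTransport_le hab hu hf hν hγ0 hγ1 heq hK ht₀ ht ht₀t hα1
    ENNReal.toReal_nonneg ENNReal.toReal_nonneg hf₀ hg'
  have hC : 0 ≤ Xi * (Hf.toReal + (t - t₀) * Hg.toReal) := by
    have : 0 ≤ (t - t₀) * Hg.toReal := mul_nonneg (sub_nonneg.2 ht₀t) ENNReal.toReal_nonneg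
    positivity
  refine (eHolderNorm_le_ofReal_of_norm_sub_le (φ := lift (f t)) hC hpt).trans (le_of_eq ?_)
  rw [ENNReal.ofReal_mul hX0.le, ENNReal.ofReal_add ENNReal.toReal_nonneg
      (mul_nonneg (sub_nonneg.2 ht₀t) ENNReal.toReal_nonneg),
    ENNReal.ofReal_mul (sub_nonneg.2 ht₀t), ENNReal.ofReal_toReal hfT, ENNReal.ofReal_toReal hgT]

/-- **Transport–diffusion estimate in `C^{0,α}(T^d)`** (De Rosa 2019, Prop. 3.2 (3.3) and
Prop. 3.3 (3.6) combined, in the accepted norm `Torus.eContDiffHolderNorm 0 α = ‖·‖_∞ + [·]_α`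
of the lift; the fractional twin of `Torus.eContDiffHolderNorm_transport_le`): for a smooth
solution of `∂ₜf + (u·∇)f + ν(-Δ)^γ f = g` on `[a,b] × T^d` (`ν ≥ 0`, `0 < γ < 1`) with
`‖Du‖ ≤ K`, `0 ≤ α < 1`, `t₀ ≤ t`, if `‖f(t₀)‖_{0,α} ≤ A` and `‖g(s)‖_{0,α} ≤ G` for
`s ∈ [t₀,t]`, then `‖f(t)‖_{0,α} ≤ e^{αK(t-t₀)} (A + 2(t - t₀) G)`.
[cite: Derosa2018, §3.1 Props. 3.2–3.3] -/
theorem eContDiffHolderNorm_fracTransport_le (hab : a < b)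
    (hu : IsSmoothSpaceTimeOn (Icc a b) u) (hf : IsSmoothSpaceTimeOn (Icc a b) f)
    (hν : 0 ≤ ν) (hγ0 : 0 < γ) (hγ1 : γ < 1)
    (heq : ∀ s ∈ Icc a b, ∀ x, timeDerivWithin (Icc a b) f s x + convect (u s) (f s) x +
      ν • fracLaplacian γ (f s) x = g s x)
    {K : ℝ≥0} (hK : ∀ s ∈ Icc a b, ∀ x, ‖Torus.fderiv (u s) x‖ ≤ K)
    {t₀ t : ℝ} (ht₀ : t₀ ∈ Icc a b) (ht : t ∈ Icc a b) (ht₀t : t₀ ≤ t) {α : ℝ≥0} (hα1 : α < 1)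
    {A G : ℝ} (hA : 0 ≤ A) (hG : 0 ≤ G)
    (hfA : Torus.eContDiffHolderNorm 0 α (f t₀) ≤ ENNReal.ofReal A)
    (hgG : ∀ s ∈ Icc t₀ t, Torus.eContDiffHolderNorm 0 α (g s) ≤ ENNReal.ofReal G) :
    Torus.eContDiffHolderNorm 0 α (f t) ≤
      ENNReal.ofReal (Real.exp (α * K * (t - t₀)) * (A + 2 * (t - t₀) * G)) := by
  set Xi : ℝ := Real.exp (α * K * (t - t₀)) with hXi
  have hT0 : 0 ≤ t - t₀ := sub_nonneg.2 ht₀t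
  have hX1 : 1 ≤ Xi := Real.one_le_exp (by positivity)
  have hsplit : ∀ (φ : UnitAddTorus d → EuclideanSpace ℝ d), Torus.eContDiffHolderNorm 0 α φ =
      eSupNorm φ + eHolderNorm α (lift φ) := fun φ => by
    rw [Torus.eContDiffHolderNorm, eContDiffHolderNorm_zero_eq, eSupNorm_lift]
  have hSg : (⨆ s ∈ Icc t₀ t, eSupNorm (g s)) ≤ ENNReal.ofReal G :=
    iSup₂_le fun s hs => le_trans (by rw [hsplit]; exact le_self_add) (hgG s hs)
  have hHg : (⨆ s ∈ Icc t₀ t, eHolderNorm α (lift (g s))) ≤ ENNReal.ofReal G :=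
    iSup₂_le fun s hs => le_trans (by rw [hsplit]; exact le_add_self) (hgG s hs)
  have h1 := eSupNorm_fracTransport_le hf hν hγ0 hγ1 heq ht₀ ht ht₀t
  have h2 := eHolderNorm_fracTransport_le hab hu hf hν hγ0 hγ1 heq hK ht₀ ht ht₀t hα1
  have hX1' : (1 : ℝ≥0∞) ≤ ENNReal.ofReal Xi := by
    rw [← ENNReal.ofReal_one]
    exact ENNReal.ofReal_le_ofReal hX1
  set cX := ENNReal.ofReal Xi with hcX
  set cT := ENNReal.ofReal (t - t₀) with hcT
  set cG := ENNReal.ofReal G with hcG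
  rw [hsplit]
  calc eSupNorm (f t) + eHolderNorm α (lift (f t))
      ≤ (eSupNorm (f t₀) + cT * cG) + cX * (eHolderNorm α (lift (f t₀)) + cT * cG) := by
        refine add_le_add (h1.trans ?_) (h2.trans ?_)
        · exact add_le_add le_rfl (mul_le_mul' le_rfl hSg)
        · exact mul_le_mul' le_rfl (add_le_add le_rfl (mul_le_mul' le_rfl hHg))
    _ ≤ cX * (eSupNorm (f t₀) + cT * cG) + cX * (eHolderNorm α (lift (f t₀)) + cT * cG) :=
        add_le_add (le_mul_of_one_le_left' hX1') le_rfl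
    _ = cX * (eSupNorm (f t₀) + eHolderNorm α (lift (f t₀))) + 2 * cX * cT * cG := by ring
    _ ≤ cX * ENNReal.ofReal A + 2 * cX * cT * cG := by
        rw [← hsplit]
        exact add_le_add (mul_le_mul' le_rfl hfA) le_rfl
    _ = ENNReal.ofReal (Xi * (A + 2 * (t - t₀) * G)) := by
        rw [hcX, hcT, hcG, ← ENNReal.ofReal_ofNat 2, ← ENNReal.ofReal_mul (zero_le_one.trans hX1),
          ← ENNReal.ofReal_mul (by norm_num), ← ENNReal.ofReal_mul (by positivity),
          ← ENNReal.ofReal_mul (by positivity), ← ENNReal.ofReal_add (by positivity) (by positivity)]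
        congr 1
        ring

end Holder

end Torus

end Literature.Analysis.FluidPDE
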